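import Summits.QuantumFields.BalabanUV.Beta.FP.NestedStepLawTransported
import Summits.QuantumFields.BalabanUV.Beta.FP.ColourDoublingBlocks

/-!
# `BalabanUV.Beta.FP.NestedStepLawTransportedGraded` — road «FP» for binder row D1, ROUTE T, presentation T-β, option (δ) «LIFT ∕ GRADED» (R-FP-54′):
# **THE ONE-SHOT-SLICED COMPOSITE STEP LAW WITH THE TRANSPORT INSERTED FIRST, FOR GRADED (COLOUR-STRIPPED) 2-JETS** — S1 `NestedStepLawTransported`
# (p319272 ∕ p321366) read through the antisymmetric colour lift `D1BFx.ColourLift` and stripped back, exactly as the graded door p323821 reads p308750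

WHY.  For the colour-stripped literal the first-order tables are ANTISYMMETRIC (F-FP-18-2: `symHessFFAt_antisymm`, `torus_H1_transpose`) and the field
transport generator is DIAGONAL (`Xᵀ = X`), so S1's two-sided letters `a*t` and its CONGRUENCE letter `k1 : A₁ᵀ𝔎₀A₀ + A₀ᵀ𝔎₁A₀ + A₀ᵀ𝔎₀A₁ = 𝔎'₁` cannot be fed
un-lifted (a symmetrised word cannot equal an antisymmetric table).  Here S1 §1 `secondVar_oneShot_nestedStepLaw_transported` is instantiated at the LIFTED
objects `1 ⊗ X₀`, `c ⊗ X₁`, `(c·c) ⊗ X₂` (`cᵀ = −c`, `tr(c·c) ≠ 0`; odd objects `H₁ G₁ Q₁₁ Q₂₁ W₁ Y₁ 𝔎₁ 𝔔₁ A₁ A′₁ Ā₁ 𝔎′₁ 𝔔′₁`), every lifted hypothesis is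
DERIVED from a GRADED one-sided stripped hypothesis by the Kronecker bookkeeping of `ColourDoublingBlocks` (sign `(−1)^(number of transposed odd objects)`
on each word), the two-sided letters come for free from the parities `𝔎₀ᵀ = 𝔎₀`, `𝔎₁ᵀ = −𝔎₁`, `𝔎₂ᵀ = 𝔎₂`, and the lifted conclusion is stripped back by
`ColourDoublingKkt.secondVar_kkt_lift_strip_zeroSlice` and `ColourDoubling.secondVar_kronecker_lift` (uniform factor `tr(c·c)`, cancelled).
RESULT (§1 `secondVar_oneShot_nestedStepLaw_transported_graded`): S1's law — one-shot literal (static `P`, own chart) `=` fine one-step sliced `+` coarse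
sliced `+ 2·secondVar ((P·A′)·W)-jets − 2·secondVar ([τ₂Q₁;τ₁]·W)-jets` — for the STRIPPED tables, with (i) the graded namings and Ward letters of the door
p323821 VERBATIM, (ii) the GRADED congruence words `k1 : −(A₁ᵀ𝔎₀A₀) + A₀ᵀ𝔎₁A₀ + A₀ᵀ𝔎₀A₁ = 𝔎′₁` and `k2` (the four words led by `A₁ᵀ` negative) — at the
record (`A₀ = 1`, `A₁ = X` diagonal) `k1` is the COMMUTATOR word `𝔎′₁ = 𝔎₁ + (𝔎₀X − X𝔎₀)` of `PeriodisedFormIndexWard(Doubled)`, (iii) the multiplier ∕ inverse ∕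
unimodularity ∕ intertwining letters `q* i* uA uĀ j* uC` ONE-SIDED and therefore UNCHANGED, (iv) the odd bordered jets (−)-PLACED and the coarse words graded
(`Bᵀ ↦ −Bᵀ`) as in the door, (v) the two displayed Faddeev–Popov 2-jets VERBATIM (plain products — grading-blind).  §2: the ZERO-DEFECT corollaries
`…_of_uni_graded` ∕ `…_of_letters_graded` by S1's own parity-free helpers `secondVar_movedOneShotFP_eq_zero(_of_uni)` ∕ `secondVar_nestedFP_eq_zero` BY NAME.
Nothing of the dictionary asserted; [folklore] throughout; no `def`, no `def … : Prop`, nothing cited, 0 sorry.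

HONEST DEPENDENCY (page 1, mandatory): continuum YM on T⁴ ⇐ BetaPertH ∧ nine spine estimates (0/9 proved); BetaPertH ⇐ (D1) ∧ (D4) ∧ CAP+tail;
G-an2-4 gates asym, D1 and NE2/3/4.  HONEST FRAMING (cell contract, verbatim): «discharging `BetaPertH` makes Bałaban's UV stability UNCONDITIONAL —
a real constructive-QFT result; it is NOT the continuum limit and NOT the Clay problem.»  ABSOLUTE RULE (cell charter, verbatim): «No internally-minted
statement may enter as a cited fact. Every hypothesis is either kernel-proved in this package or a verbatim quotation of a PUBLISHED theorem with page
reference. The manuscript(s) under audit are NOT citable for their own disputed steps — they are the thing under adjudication; programme-internal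
(2001/route/tribunal) claims are never citable.»  0 estimates; 0∕4 row-D1 binders; NOT (T-ID), NOT SDF, NOT D1, NOT BetaPertH, NOT continuum, NOT Clay.
Road «FP» OWNER, b2b-balaban-beta-d1-p3 gen 19, 2026-08-22.  No existing file touched.
-/

noncomputable section

namespace Summit.QuantumFields.BalabanUV.Beta.FP.NestedStepLawTransportedGraded

open Matrix
open scoped Kronecker
open Literature.MathematicalPhysics.QuantumFieldTheory.Balaban1983to89.Beta.Composition (kkt)
open Literature.MathematicalPhysics.QuantumFieldTheory.Balaban1983to89.Beta.CompositionSingular (effForm flucCov minOp minOpL)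
open Summit.QuantumFields.BalabanUV.Beta.D1BFx.LogDetSecondVariation (secondVar)
open Summit.QuantumFields.BalabanUV.Beta.D1BFx.ColourLift (e₂ e₃ kkt_kronecker_symm kronecker_transpose' neg_kronecker kronecker_neg det_kkt_lift_ne_zero
  det_one_kronecker_ne_zero)
open Summit.QuantumFields.BalabanUV.Beta.FP.ColourDoubling (secondVar_kronecker_lift)
open Summit.QuantumFields.BalabanUV.Beta.FP.ColourDoublingKkt (secondVar_reindex secondVar_kkt_lift_strip_zeroSlice)
open Summit.QuantumFields.BalabanUV.Beta.FP.ColourDoublingBlocks (submatrix_id_mul mul_submatrix_id toBlocks₁₁_lift flucCov_lift minOp_lift minOpL_lift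
  effForm_lift fromRows_lift fromRows_lift_zero neg_kronecker_comm add_lift sub_lift neg_lift smul_lift kron_sub kron_add kron_neg kron_smul
  secondVar_submatrix_equiv kkt_fromRows_submatrix)
open Summit.QuantumFields.BalabanUV.Beta.FP.NestedStepLawTransported (secondVar_oneShot_nestedStepLaw_transported secondVar_movedOneShotFP_eq_zero
  secondVar_movedOneShotFP_eq_zero_of_uni secondVar_nestedFP_eq_zero)

variable {l ν μ κ ρ₁ ρ₂ : Type*} [Fintype l] [Fintype ν] [Fintype μ] [Fintype κ] [Fintype ρ₁] [Fintype ρ₂]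
  [DecidableEq l] [DecidableEq ν] [DecidableEq μ] [DecidableEq κ] [DecidableEq ρ₁] [DecidableEq ρ₂]

/-! ## §1 The graded transported law with the two chart-native Faddeev–Popov 2-jets displayed -/

set_option linter.unusedSimpArgs false in
set_option maxHeartbeats 2000000 in
/-- [folklore] **THE ONE-SHOT-SLICED COMPOSITE STEP LAW, TRANSPORT FIRST (T-β), FOR GRADED 2-JETS** (S1 §1 through the antisymmetric colour lift `c`,
`cᵀ = −c`, `tr(c·c) ≠ 0`, stripped back).  Data as in `NestedStepLawTransported.secondVar_oneShot_nestedStepLaw_transported`; the namings `h𝔎ₙ`, the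
Ward letters `a0 a1 a2` and the congruence words `k1 k2` in their GRADED shapes (sign `(−1)^(number of transposed odd objects)` on each word), the parities
`𝔎₀ᵀ = 𝔎₀`, `𝔎₁ᵀ = −𝔎₁`, `𝔎₂ᵀ = 𝔎₂` in place of the two-sided letters; `q* i* uA uĀ hA hĀ hPW hTW hPAW hΓ hI hL hS hB h1 h2` unchanged.  CONCLUSION:
S1's law with the odd bordered jets (−)-PLACED, the coarse words graded (`Bᵀ ↦ −Bᵀ`), and the two chart-native Faddeev–Popov 2-jets displayed verbatim. -/
theorem secondVar_oneShot_nestedStepLaw_transported_graded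
    (c : Matrix l l ℝ) (hc : cᵀ = -c) (htr : (c * c).trace ≠ 0)
    (H₀ H₁ H₂ : Matrix ν ν ℝ) (Q₁₀ Q₁₁ Q₁₂ : Matrix μ ν ℝ) (Q₂₀ Q₂₁ Q₂₂ : Matrix κ μ ℝ) (G₀ G₁ G₂ : Matrix μ μ ℝ)
    (τ₁ : Matrix ρ₁ ν ℝ) (τ₂ : Matrix ρ₂ μ ℝ) (P : Matrix (ρ₂ ⊕ ρ₁) ν ℝ) (W₀ W₁ W₂ : Matrix ν (ρ₂ ⊕ ρ₁) ℝ) (Y₀ Y₁ Y₂ : Matrix κ (ρ₂ ⊕ ρ₁) ℝ)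
    (A₀ A₁ A₂ A'₀ A'₁ A'₂ : Matrix ν ν ℝ) (Ā₀ Ā₁ Ā₂ : Matrix κ κ ℝ)
    {𝔎₀ 𝔎₁ 𝔎₂ : Matrix ν ν ℝ} {𝔔₀ 𝔔₁ 𝔔₂ : Matrix κ ν ℝ}
    -- GRADED namings of the composite jets of the NESTED chart (as the door p323821)
    (h𝔎₀ : H₀ + Q₁₀ᵀ * G₀ * Q₁₀ = 𝔎₀) (h𝔎₁ : H₁ + (-(Q₁₁ᵀ * G₀ * Q₁₀) + Q₁₀ᵀ * G₁ * Q₁₀ + Q₁₀ᵀ * G₀ * Q₁₁) = 𝔎₁)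
    (h𝔎₂ : H₂ + ((Q₁₂ᵀ * G₀ * Q₁₀ + -(Q₁₁ᵀ * G₁ * Q₁₀) + -(Q₁₁ᵀ * G₀ * Q₁₁)) + (-(Q₁₁ᵀ * G₁ * Q₁₀) + Q₁₀ᵀ * G₂ * Q₁₀ + Q₁₀ᵀ * G₁ * Q₁₁)
            + (-(Q₁₁ᵀ * G₀ * Q₁₁) + Q₁₀ᵀ * G₁ * Q₁₁ + Q₁₀ᵀ * G₀ * Q₁₂)) = 𝔎₂)
    (h𝔔₀ : Q₂₀ * Q₁₀ = 𝔔₀) (h𝔔₁ : Q₂₁ * Q₁₀ + Q₂₀ * Q₁₁ = 𝔔₁) (h𝔔₂ : Q₂₂ * Q₁₀ + Q₂₁ * Q₁₁ + (Q₂₁ * Q₁₁ + Q₂₀ * Q₁₂) = 𝔔₂)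
    -- (T-β-1) GRADED: the ONE-SHOT literal's composite jets are the graded conjugated words, NAMED (words led by `A₁ᵀ` negative)
    {𝔎'₀ 𝔎'₁ 𝔎'₂ : Matrix ν ν ℝ} {𝔔'₀ 𝔔'₁ 𝔔'₂ : Matrix κ ν ℝ}
    (k0 : A₀ᵀ * 𝔎₀ * A₀ = 𝔎'₀) (k1 : -(A₁ᵀ * 𝔎₀ * A₀) + A₀ᵀ * 𝔎₁ * A₀ + A₀ᵀ * 𝔎₀ * A₁ = 𝔎'₁)
    (k2 : A₂ᵀ * 𝔎₀ * A₀ + (-(A₁ᵀ * 𝔎₁ * A₀) + -(A₁ᵀ * 𝔎₀ * A₁))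
            + ((-(A₁ᵀ * 𝔎₁ * A₀) + -(A₁ᵀ * 𝔎₀ * A₁)) + (A₀ᵀ * 𝔎₂ * A₀ + A₀ᵀ * 𝔎₁ * A₁ + (A₀ᵀ * 𝔎₁ * A₁ + A₀ᵀ * 𝔎₀ * A₂))) = 𝔎'₂)
    (q0 : Ā₀ * 𝔔₀ * A₀ = 𝔔'₀) (q1 : Ā₁ * 𝔔₀ * A₀ + Ā₀ * 𝔔₁ * A₀ + Ā₀ * 𝔔₀ * A₁ = 𝔔'₁)
    (q2 : Ā₂ * 𝔔₀ * A₀ + (Ā₁ * 𝔔₁ * A₀ + Ā₁ * 𝔔₀ * A₁)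
            + ((Ā₁ * 𝔔₁ * A₀ + Ā₁ * 𝔔₀ * A₁) + (Ā₀ * 𝔔₂ * A₀ + Ā₀ * 𝔔₁ * A₁ + (Ā₀ * 𝔔₁ * A₁ + Ā₀ * 𝔔₀ * A₂))) = 𝔔'₂)
    -- (T-β-2) unimodular transports, (T-β-3) inverse letters (one-sided: unchanged by the grading)
    (hA : A₀.det ≠ 0) (hĀ : Ā₀.det ≠ 0)
    (i0 : A'₀ * A₀ = 1) (i1 : A'₁ * A₀ + A'₀ * A₁ = 0) (i2 : A'₂ * A₀ + (2 : ℝ) • (A'₁ * A₁) + A'₀ * A₂ = 0)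
    (uA : secondVar A₀ A₁ A₂ = 0) (uĀ : secondVar Ā₀ Ā₁ Ā₂ = 0)
    -- parities of the composite form jets of the nested chart (the two-sided letters follow)
    (h𝔎₀t : 𝔎₀ᵀ = 𝔎₀) (h𝔎₁t : 𝔎₁ᵀ = -𝔎₁) (h𝔎₂t : 𝔎₂ᵀ = 𝔎₂)
    -- GRADED one-sided Ward letters of the composite system, NESTED chart (as the door p323821)
    (a0 : 𝔎₀ * W₀ = 𝔔₀ᵀ * Y₀) (a1 : 𝔎₁ * W₀ + 𝔎₀ * W₁ = -(𝔔₁ᵀ * Y₀) + 𝔔₀ᵀ * Y₁)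
    (a2 : 𝔎₂ * W₀ + (2 : ℝ) • (𝔎₁ * W₁) + 𝔎₀ * W₂ = 𝔔₂ᵀ * Y₀ + -((2 : ℝ) • (𝔔₁ᵀ * Y₁)) + 𝔔₀ᵀ * Y₂)
    (b0 : 𝔔₀ * W₀ = 0) (b1 : 𝔔₁ * W₀ + 𝔔₀ * W₁ = 0) (b2 : 𝔔₂ * W₀ + (2 : ℝ) • (𝔔₁ * W₁) + 𝔔₀ * W₂ = 0)
    -- the three Faddeev–Popov operators at `0` are non-degenerate (one-shot, nested, moved one-shot)
    (hPW : (P * W₀).det ≠ 0) (hTW : (fromRows (τ₂ * Q₁₀) τ₁ * W₀).det ≠ 0) (hPAW : (P * A'₀ * W₀).det ≠ 0)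
    {Γ : Matrix ν ν ℝ} {I : Matrix ν (μ ⊕ ρ₁) ℝ} {L : Matrix (μ ⊕ ρ₁) ν ℝ} {S : Matrix (μ ⊕ ρ₁) (μ ⊕ ρ₁) ℝ} {B : Matrix (μ ⊕ ρ₁) ν ℝ}
    (hΓ : flucCov H₀ (fromRows Q₁₀ τ₁) = Γ) (hI : minOp H₀ (fromRows Q₁₀ τ₁) = I) (hL : minOpL H₀ (fromRows Q₁₀ τ₁) = L) (hS : effForm H₀ (fromRows Q₁₀ τ₁) = S)
    (hB : fromRows Q₁₁ (0 : Matrix ρ₁ ν ℝ) = B)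
    (h1 : (kkt H₀ (fromRows Q₁₀ τ₁)).det ≠ 0)
    (h2 : (kkt (S.toBlocks₁₁ + G₀) (fromRows Q₂₀ τ₂)).det ≠ 0) :
    secondVar (kkt 𝔎'₀ (fromRows 𝔔'₀ P))
        (fromBlocks 𝔎'₁ (-(fromRows 𝔔'₁ (0 : Matrix (ρ₂ ⊕ ρ₁) ν ℝ))ᵀ) (fromRows 𝔔'₁ (0 : Matrix (ρ₂ ⊕ ρ₁) ν ℝ)) 0)
        (kkt 𝔎'₂ (fromRows 𝔔'₂ (0 : Matrix (ρ₂ ⊕ ρ₁) ν ℝ)))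
      = secondVar (kkt H₀ (fromRows Q₁₀ τ₁)) (fromBlocks H₁ (-Bᵀ) B 0) (kkt H₂ (fromRows Q₁₂ (0 : Matrix ρ₁ ν ℝ)))
        + secondVar
            (kkt (S.toBlocks₁₁ + G₀) (fromRows Q₂₀ τ₂))
            (fromBlocks (((L * H₁ - S * B) * I + L * Bᵀ * S).toBlocks₁₁ + G₁) (-(fromRows Q₂₁ (0 : Matrix ρ₂ μ ℝ))ᵀ)
              (fromRows Q₂₁ (0 : Matrix ρ₂ μ ℝ)) 0)
            (kkt ((((-((L * H₁ - S * B) * Γ - L * Bᵀ * L) * H₁ + L * H₂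
                      - (((L * H₁ - S * B) * I + L * Bᵀ * S) * B + S * fromRows Q₁₂ (0 : Matrix ρ₁ ν ℝ))) * I
                    + (L * H₁ - S * B) * (-((Γ * H₁ + I * B) * I + Γ * Bᵀ * S)))
                  - ((-((L * H₁ - S * B) * Γ - L * Bᵀ * L) * (-Bᵀ) + L * (fromRows Q₁₂ (0 : Matrix ρ₁ ν ℝ))ᵀ) * S
                      + L * (-Bᵀ) * ((L * H₁ - S * B) * I + L * Bᵀ * S))).toBlocks₁₁ + G₂)
              (fromRows Q₂₂ (0 : Matrix ρ₂ μ ℝ)))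
        + (2 * secondVar (P * A'₀ * W₀) (P * A'₁ * W₀ + P * A'₀ * W₁) (P * A'₂ * W₀ + P * A'₁ * W₁ + (P * A'₁ * W₁ + P * A'₀ * W₂))
          - 2 * secondVar (fromRows (τ₂ * Q₁₀) τ₁ * W₀) (fromRows (τ₂ * Q₁₁) (0 : Matrix ρ₁ ν ℝ) * W₀ + fromRows (τ₂ * Q₁₀) τ₁ * W₁)
              (fromRows (τ₂ * Q₁₂) (0 : Matrix ρ₁ ν ℝ) * W₀ + fromRows (τ₂ * Q₁₁) (0 : Matrix ρ₁ ν ℝ) * W₁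
                + (fromRows (τ₂ * Q₁₁) (0 : Matrix ρ₁ ν ℝ) * W₁ + fromRows (τ₂ * Q₁₀) τ₁ * W₂))) := by
  subst hB
  -- (1) every LIFTED hypothesis of S1 from its graded stripped twin (blocks shared with the door p323821 verbatim)
  have h𝔎₀' : ((1 : Matrix l l ℝ) ⊗ₖ H₀) + ((1 : Matrix l l ℝ) ⊗ₖ Q₁₀)ᵀ * ((1 : Matrix l l ℝ) ⊗ₖ G₀) * ((1 : Matrix l l ℝ) ⊗ₖ Q₁₀) = ((1 : Matrix l l ℝ) ⊗ₖ 𝔎₀) := by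
    have h := h𝔎₀; simp only [Matrix.transpose_submatrix, kronecker_transpose', hc, Matrix.transpose_one, Matrix.transpose_mul, Matrix.transpose_transpose, Matrix.sub_mul, Matrix.mul_sub, Matrix.add_mul, Matrix.mul_add, Matrix.neg_mul, Matrix.mul_neg, Matrix.smul_mul, Matrix.mul_smul, submatrix_id_mul, mul_submatrix_id, Matrix.submatrix_mul_equiv, Matrix.submatrix_submatrix, Function.comp_id, Function.id_comp, ← Matrix.mul_kronecker_mul, Matrix.one_mul, Matrix.mul_one, neg_mul, mul_neg, neg_neg, neg_kronecker_comm, add_lift, sub_lift, neg_lift, smul_lift, kron_add, kron_sub, kron_neg, kron_smul, toBlocks₁₁_lift, sub_neg_eq_add, Matrix.mul_assoc, smul_neg, neg_add_rev, fromRows_lift, fromRows_lift_zero] at h ⊢; rw [h]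
  have h𝔎₁' : (c ⊗ₖ H₁) + ((c ⊗ₖ Q₁₁)ᵀ * ((1 : Matrix l l ℝ) ⊗ₖ G₀) * ((1 : Matrix l l ℝ) ⊗ₖ Q₁₀) + ((1 : Matrix l l ℝ) ⊗ₖ Q₁₀)ᵀ * (c ⊗ₖ G₁) * ((1 : Matrix l l ℝ) ⊗ₖ Q₁₀)
      + ((1 : Matrix l l ℝ) ⊗ₖ Q₁₀)ᵀ * ((1 : Matrix l l ℝ) ⊗ₖ G₀) * (c ⊗ₖ Q₁₁)) = (c ⊗ₖ 𝔎₁) := by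
    have h := h𝔎₁; simp only [Matrix.transpose_submatrix, kronecker_transpose', hc, Matrix.transpose_one, Matrix.transpose_mul, Matrix.transpose_transpose, Matrix.sub_mul, Matrix.mul_sub, Matrix.add_mul, Matrix.mul_add, Matrix.neg_mul, Matrix.mul_neg, Matrix.smul_mul, Matrix.mul_smul, submatrix_id_mul, mul_submatrix_id, Matrix.submatrix_mul_equiv, Matrix.submatrix_submatrix, Function.comp_id, Function.id_comp, ← Matrix.mul_kronecker_mul, Matrix.one_mul, Matrix.mul_one, neg_mul, mul_neg, neg_neg, neg_kronecker_comm, add_lift, sub_lift, neg_lift, smul_lift, kron_add, kron_sub, kron_neg, kron_smul, toBlocks₁₁_lift, sub_neg_eq_add, Matrix.mul_assoc, smul_neg, neg_add_rev, fromRows_lift, fromRows_lift_zero] at h ⊢; rw [h]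
  have h𝔎₂' : ((c * c) ⊗ₖ H₂) + ((((c * c) ⊗ₖ Q₁₂)ᵀ * ((1 : Matrix l l ℝ) ⊗ₖ G₀) * ((1 : Matrix l l ℝ) ⊗ₖ Q₁₀) + (c ⊗ₖ Q₁₁)ᵀ * (c ⊗ₖ G₁) * ((1 : Matrix l l ℝ) ⊗ₖ Q₁₀)
      + (c ⊗ₖ Q₁₁)ᵀ * ((1 : Matrix l l ℝ) ⊗ₖ G₀) * (c ⊗ₖ Q₁₁)) + ((c ⊗ₖ Q₁₁)ᵀ * (c ⊗ₖ G₁) * ((1 : Matrix l l ℝ) ⊗ₖ Q₁₀) + ((1 : Matrix l l ℝ) ⊗ₖ Q₁₀)ᵀ * ((c * c) ⊗ₖ G₂) * ((1 : Matrix l l ℝ) ⊗ₖ Q₁₀)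
      + ((1 : Matrix l l ℝ) ⊗ₖ Q₁₀)ᵀ * (c ⊗ₖ G₁) * (c ⊗ₖ Q₁₁)) + ((c ⊗ₖ Q₁₁)ᵀ * ((1 : Matrix l l ℝ) ⊗ₖ G₀) * (c ⊗ₖ Q₁₁) + ((1 : Matrix l l ℝ) ⊗ₖ Q₁₀)ᵀ * (c ⊗ₖ G₁) * (c ⊗ₖ Q₁₁)
      + ((1 : Matrix l l ℝ) ⊗ₖ Q₁₀)ᵀ * ((1 : Matrix l l ℝ) ⊗ₖ G₀) * ((c * c) ⊗ₖ Q₁₂))) = ((c * c) ⊗ₖ 𝔎₂) := by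
    have h := h𝔎₂; simp only [Matrix.transpose_submatrix, kronecker_transpose', hc, Matrix.transpose_one, Matrix.transpose_mul, Matrix.transpose_transpose, Matrix.sub_mul, Matrix.mul_sub, Matrix.add_mul, Matrix.mul_add, Matrix.neg_mul, Matrix.mul_neg, Matrix.smul_mul, Matrix.mul_smul, submatrix_id_mul, mul_submatrix_id, Matrix.submatrix_mul_equiv, Matrix.submatrix_submatrix, Function.comp_id, Function.id_comp, ← Matrix.mul_kronecker_mul, Matrix.one_mul, Matrix.mul_one, neg_mul, mul_neg, neg_neg, neg_kronecker_comm, add_lift, sub_lift, neg_lift, smul_lift, kron_add, kron_sub, kron_neg, kron_smul, toBlocks₁₁_lift, sub_neg_eq_add, Matrix.mul_assoc, smul_neg, neg_add_rev, fromRows_lift, fromRows_lift_zero] at h ⊢; rw [h]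
  have h𝔔₀' : ((1 : Matrix l l ℝ) ⊗ₖ Q₂₀) * ((1 : Matrix l l ℝ) ⊗ₖ Q₁₀) = ((1 : Matrix l l ℝ) ⊗ₖ 𝔔₀) := by
    have h := h𝔔₀; simp only [Matrix.transpose_submatrix, kronecker_transpose', hc, Matrix.transpose_one, Matrix.transpose_mul, Matrix.transpose_transpose, Matrix.sub_mul, Matrix.mul_sub, Matrix.add_mul, Matrix.mul_add, Matrix.neg_mul, Matrix.mul_neg, Matrix.smul_mul, Matrix.mul_smul, submatrix_id_mul, mul_submatrix_id, Matrix.submatrix_mul_equiv, Matrix.submatrix_submatrix, Function.comp_id, Function.id_comp, ← Matrix.mul_kronecker_mul, Matrix.one_mul, Matrix.mul_one, neg_mul, mul_neg, neg_neg, neg_kronecker_comm, add_lift, sub_lift, neg_lift, smul_lift, kron_add, kron_sub, kron_neg, kron_smul, toBlocks₁₁_lift, sub_neg_eq_add, Matrix.mul_assoc, smul_neg, neg_add_rev, fromRows_lift, fromRows_lift_zero] at h ⊢; rw [h]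
  have h𝔔₁' : (c ⊗ₖ Q₂₁) * ((1 : Matrix l l ℝ) ⊗ₖ Q₁₀) + ((1 : Matrix l l ℝ) ⊗ₖ Q₂₀) * (c ⊗ₖ Q₁₁) = (c ⊗ₖ 𝔔₁) := by
    have h := h𝔔₁; simp only [Matrix.transpose_submatrix, kronecker_transpose', hc, Matrix.transpose_one, Matrix.transpose_mul, Matrix.transpose_transpose, Matrix.sub_mul, Matrix.mul_sub, Matrix.add_mul, Matrix.mul_add, Matrix.neg_mul, Matrix.mul_neg, Matrix.smul_mul, Matrix.mul_smul, submatrix_id_mul, mul_submatrix_id, Matrix.submatrix_mul_equiv, Matrix.submatrix_submatrix, Function.comp_id, Function.id_comp, ← Matrix.mul_kronecker_mul, Matrix.one_mul, Matrix.mul_one, neg_mul, mul_neg, neg_neg, neg_kronecker_comm, add_lift, sub_lift, neg_lift, smul_lift, kron_add, kron_sub, kron_neg, kron_smul, toBlocks₁₁_lift, sub_neg_eq_add, Matrix.mul_assoc, smul_neg, neg_add_rev, fromRows_lift, fromRows_lift_zero] at h ⊢; rw [h]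
  have h𝔔₂' : ((c * c) ⊗ₖ Q₂₂) * ((1 : Matrix l l ℝ) ⊗ₖ Q₁₀) + (c ⊗ₖ Q₂₁) * (c ⊗ₖ Q₁₁) + ((c ⊗ₖ Q₂₁) * (c ⊗ₖ Q₁₁) + ((1 : Matrix l l ℝ) ⊗ₖ Q₂₀) * ((c * c) ⊗ₖ Q₁₂))
      = ((c * c) ⊗ₖ 𝔔₂) := by
    have h := h𝔔₂; simp only [Matrix.transpose_submatrix, kronecker_transpose', hc, Matrix.transpose_one, Matrix.transpose_mul, Matrix.transpose_transpose, Matrix.sub_mul, Matrix.mul_sub, Matrix.add_mul, Matrix.mul_add, Matrix.neg_mul, Matrix.mul_neg, Matrix.smul_mul, Matrix.mul_smul, submatrix_id_mul, mul_submatrix_id, Matrix.submatrix_mul_equiv, Matrix.submatrix_submatrix, Function.comp_id, Function.id_comp, ← Matrix.mul_kronecker_mul, Matrix.one_mul, Matrix.mul_one, neg_mul, mul_neg, neg_neg, neg_kronecker_comm, add_lift, sub_lift, neg_lift, smul_lift, kron_add, kron_sub, kron_neg, kron_smul, toBlocks₁₁_lift, sub_neg_eq_add, Matrix.mul_assoc,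 smul_neg, neg_add_rev, fromRows_lift, fromRows_lift_zero] at h ⊢; rw [h]
  have a0' : ((1 : Matrix l l ℝ) ⊗ₖ 𝔎₀) * (((1 : Matrix l l ℝ) ⊗ₖ W₀).submatrix id (e₂ l ρ₂ ρ₁).symm) = ((1 : Matrix l l ℝ) ⊗ₖ 𝔔₀)ᵀ * (((1 : Matrix l l ℝ) ⊗ₖ Y₀).submatrix id (e₂ l ρ₂ ρ₁).symm) := by
    have h := a0; simp only [Matrix.transpose_submatrix, kronecker_transpose', hc, Matrix.transpose_one, Matrix.transpose_mul, Matrix.transpose_transpose, Matrix.sub_mul, Matrix.mul_sub, Matrix.add_mul, Matrix.mul_add, Matrix.neg_mul, Matrix.mul_neg, Matrix.smul_mul, Matrix.mul_smul, submatrix_id_mul, mul_submatrix_id, Matrix.submatrix_mul_equiv, Matrix.submatrix_submatrix, Function.comp_id, Function.id_comp, ← Matrix.mul_kronecker_mul, Matrix.one_mul, Matrix.mul_one, neg_mul, mul_neg, neg_neg, neg_kronecker_comm, add_lift, sub_lift, neg_lift, smul_lift, kron_add, kron_sub, kron_neg, kron_smul, toBlocks₁₁_lift, sub_neg_eq_add,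 Matrix.mul_assoc, smul_neg, neg_add_rev, fromRows_lift, fromRows_lift_zero] at h ⊢; rw [h]
  have a1' : (c ⊗ₖ 𝔎₁) * (((1 : Matrix l l ℝ) ⊗ₖ W₀).submatrix id (e₂ l ρ₂ ρ₁).symm) + ((1 : Matrix l l ℝ) ⊗ₖ 𝔎₀) * ((c ⊗ₖ W₁).submatrix id (e₂ l ρ₂ ρ₁).symm) = (c ⊗ₖ 𝔔₁)ᵀ * (((1 : Matrix l l ℝ) ⊗ₖ Y₀).submatrix id (e₂ l ρ₂ ρ₁).symm) + ((1 : Matrix l l ℝ) ⊗ₖ 𝔔₀)ᵀ * ((c ⊗ₖ Y₁).submatrix id (e₂ l ρ₂ ρ₁).symm) := by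
    have h := a1; simp only [Matrix.transpose_submatrix, kronecker_transpose', hc, Matrix.transpose_one, Matrix.transpose_mul, Matrix.transpose_transpose, Matrix.sub_mul, Matrix.mul_sub, Matrix.add_mul, Matrix.mul_add, Matrix.neg_mul, Matrix.mul_neg, Matrix.smul_mul, Matrix.mul_smul, submatrix_id_mul, mul_submatrix_id, Matrix.submatrix_mul_equiv, Matrix.submatrix_submatrix, Function.comp_id, Function.id_comp, ← Matrix.mul_kronecker_mul, Matrix.one_mul, Matrix.mul_one, neg_mul, mul_neg, neg_neg, neg_kronecker_comm, add_lift, sub_lift, neg_lift, smul_lift, kron_add, kron_sub, kron_neg, kron_smul, toBlocks₁₁_lift, sub_neg_eq_add, Matrix.mul_assoc, smul_neg, neg_add_rev, fromRows_lift, fromRows_lift_zero] at h ⊢; rw [h]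
  have a2' : ((c * c) ⊗ₖ 𝔎₂) * (((1 : Matrix l l ℝ) ⊗ₖ W₀).submatrix id (e₂ l ρ₂ ρ₁).symm) + (2 : ℝ) • ((c ⊗ₖ 𝔎₁) * ((c ⊗ₖ W₁).submatrix id (e₂ l ρ₂ ρ₁).symm)) + ((1 : Matrix l l ℝ) ⊗ₖ 𝔎₀) * (((c * c) ⊗ₖ W₂).submatrix id (e₂ l ρ₂ ρ₁).symm)
      = ((c * c) ⊗ₖ 𝔔₂)ᵀ * (((1 : Matrix l l ℝ) ⊗ₖ Y₀).submatrix id (e₂ l ρ₂ ρ₁).symm) + (2 : ℝ) • ((c ⊗ₖ 𝔔₁)ᵀ * ((c ⊗ₖ Y₁).submatrix id (e₂ l ρ₂ ρ₁).symm)) + ((1 : Matrix l l ℝ) ⊗ₖ 𝔔₀)ᵀ * (((c * c) ⊗ₖ Y₂).submatrix id (e₂ l ρ₂ ρ₁).symm) := by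
    have h := a2; simp only [Matrix.transpose_submatrix, kronecker_transpose', hc, Matrix.transpose_one, Matrix.transpose_mul, Matrix.transpose_transpose, Matrix.sub_mul, Matrix.mul_sub, Matrix.add_mul, Matrix.mul_add, Matrix.neg_mul, Matrix.mul_neg, Matrix.smul_mul, Matrix.mul_smul, submatrix_id_mul, mul_submatrix_id, Matrix.submatrix_mul_equiv, Matrix.submatrix_submatrix, Function.comp_id, Function.id_comp, ← Matrix.mul_kronecker_mul, Matrix.one_mul, Matrix.mul_one, neg_mul, mul_neg, neg_neg, neg_kronecker_comm, add_lift, sub_lift, neg_lift, smul_lift, kron_add, kron_sub, kron_neg, kron_smul, toBlocks₁₁_lift, sub_neg_eq_add, Matrix.mul_assoc, smul_neg, neg_add_rev, fromRows_lift, fromRows_lift_zero] at h ⊢; rw [h]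
  have a0t' : ((1 : Matrix l l ℝ) ⊗ₖ 𝔎₀)ᵀ * (((1 : Matrix l l ℝ) ⊗ₖ W₀).submatrix id (e₂ l ρ₂ ρ₁).symm) = ((1 : Matrix l l ℝ) ⊗ₖ 𝔔₀)ᵀ * (((1 : Matrix l l ℝ) ⊗ₖ Y₀).submatrix id (e₂ l ρ₂ ρ₁).symm) := by
    have h := a0; simp only [Matrix.transpose_submatrix, kronecker_transpose', hc, Matrix.transpose_one, Matrix.transpose_mul, Matrix.transpose_transpose, Matrix.sub_mul, Matrix.mul_sub, Matrix.add_mul, Matrix.mul_add, Matrix.neg_mul, Matrix.mul_neg, Matrix.smul_mul, Matrix.mul_smul, submatrix_id_mul, mul_submatrix_id, Matrix.submatrix_mul_equiv, Matrix.submatrix_submatrix, Function.comp_id, Function.id_comp, ← Matrix.mul_kronecker_mul, Matrix.one_mul, Matrix.mul_one, neg_mul, mul_neg, neg_neg, neg_kronecker_comm, add_lift, sub_lift, neg_lift, smul_lift, kron_add, kron_sub, kron_neg, kron_smul, toBlocks₁₁_lift, sub_neg_eq_add, Matrix.mul_assoc, smul_neg, neg_add_rev, fromRows_lift, fromRows_lift_zero,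 h𝔎₀t] at h ⊢; rw [h]
  have a1t' : (c ⊗ₖ 𝔎₁)ᵀ * (((1 : Matrix l l ℝ) ⊗ₖ W₀).submatrix id (e₂ l ρ₂ ρ₁).symm) + ((1 : Matrix l l ℝ) ⊗ₖ 𝔎₀)ᵀ * ((c ⊗ₖ W₁).submatrix id (e₂ l ρ₂ ρ₁).symm) = (c ⊗ₖ 𝔔₁)ᵀ * (((1 : Matrix l l ℝ) ⊗ₖ Y₀).submatrix id (e₂ l ρ₂ ρ₁).symm) + ((1 : Matrix l l ℝ) ⊗ₖ 𝔔₀)ᵀ * ((c ⊗ₖ Y₁).submatrix id (e₂ l ρ₂ ρ₁).symm) := by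
    have h := a1; simp only [Matrix.transpose_submatrix, kronecker_transpose', hc, Matrix.transpose_one, Matrix.transpose_mul, Matrix.transpose_transpose, Matrix.sub_mul, Matrix.mul_sub, Matrix.add_mul, Matrix.mul_add, Matrix.neg_mul, Matrix.mul_neg, Matrix.smul_mul, Matrix.mul_smul, submatrix_id_mul, mul_submatrix_id, Matrix.submatrix_mul_equiv, Matrix.submatrix_submatrix, Function.comp_id, Function.id_comp, ← Matrix.mul_kronecker_mul, Matrix.one_mul, Matrix.mul_one, neg_mul, mul_neg, neg_neg, neg_kronecker_comm, add_lift, sub_lift, neg_lift, smul_lift, kron_add, kron_sub, kron_neg, kron_smul, toBlocks₁₁_lift, sub_neg_eq_add, Matrix.mul_assoc, smul_neg, neg_add_rev, fromRows_lift, fromRows_lift_zero, h𝔎₀t, h𝔎₁t] at h ⊢; rw [h]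
  have a2t' : ((c * c) ⊗ₖ 𝔎₂)ᵀ * (((1 : Matrix l l ℝ) ⊗ₖ W₀).submatrix id (e₂ l ρ₂ ρ₁).symm) + (2 : ℝ) • ((c ⊗ₖ 𝔎₁)ᵀ * ((c ⊗ₖ W₁).submatrix id (e₂ l ρ₂ ρ₁).symm)) + ((1 : Matrix l l ℝ) ⊗ₖ 𝔎₀)ᵀ * (((c * c) ⊗ₖ W₂).submatrix id (e₂ l ρ₂ ρ₁).symm)
      = ((c * c) ⊗ₖ 𝔔₂)ᵀ * (((1 : Matrix l l ℝ) ⊗ₖ Y₀).submatrix id (e₂ l ρ₂ ρ₁).symm) + (2 : ℝ) • ((c ⊗ₖ 𝔔₁)ᵀ * ((c ⊗ₖ Y₁).submatrix id (e₂ l ρ₂ ρ₁).symm)) + ((1 : Matrix l l ℝ) ⊗ₖ 𝔔₀)ᵀ * (((c * c) ⊗ₖ Y₂).submatrix id (e₂ l ρ₂ ρ₁).symm) := by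
    have h := a2; simp only [Matrix.transpose_submatrix, kronecker_transpose', hc, Matrix.transpose_one, Matrix.transpose_mul, Matrix.transpose_transpose, Matrix.sub_mul, Matrix.mul_sub, Matrix.add_mul, Matrix.mul_add, Matrix.neg_mul, Matrix.mul_neg, Matrix.smul_mul, Matrix.mul_smul, submatrix_id_mul, mul_submatrix_id, Matrix.submatrix_mul_equiv, Matrix.submatrix_submatrix, Function.comp_id, Function.id_comp, ← Matrix.mul_kronecker_mul, Matrix.one_mul, Matrix.mul_one, neg_mul, mul_neg, neg_neg, neg_kronecker_comm, add_lift, sub_lift, neg_lift, smul_lift, kron_add, kron_sub, kron_neg, kron_smul, toBlocks₁₁_lift, sub_neg_eq_add, Matrix.mul_assoc, smul_neg, neg_add_rev, fromRows_lift, fromRows_lift_zero, h𝔎₀t, h𝔎₁t, h𝔎₂t] at h ⊢; rw [h]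
  have b0' : ((1 : Matrix l l ℝ) ⊗ₖ 𝔔₀) * (((1 : Matrix l l ℝ) ⊗ₖ W₀).submatrix id (e₂ l ρ₂ ρ₁).symm) = 0 := by
    have h := b0; simp only [Matrix.transpose_submatrix, kronecker_transpose', hc, Matrix.transpose_one, Matrix.transpose_mul, Matrix.transpose_transpose, Matrix.sub_mul, Matrix.mul_sub, Matrix.add_mul, Matrix.mul_add, Matrix.neg_mul, Matrix.mul_neg, Matrix.smul_mul, Matrix.mul_smul, submatrix_id_mul, mul_submatrix_id, Matrix.submatrix_mul_equiv, Matrix.submatrix_submatrix, Function.comp_id, Function.id_comp, ← Matrix.mul_kronecker_mul, Matrix.one_mul, Matrix.mul_one, neg_mul, mul_neg, neg_neg, neg_kronecker_comm, add_lift, sub_lift, neg_lift, smul_lift, kron_add, kron_sub, kron_neg, kron_smul, toBlocks₁₁_lift, sub_neg_eq_add, Matrix.mul_assoc, smul_neg, neg_add_rev, fromRows_lift, fromRows_lift_zero] at h ⊢; rw [h, Matrix.kronecker_zero, Matrix.submatrix_zero]; rfl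
  have b1' : (c ⊗ₖ 𝔔₁) * (((1 : Matrix l l ℝ) ⊗ₖ W₀).submatrix id (e₂ l ρ₂ ρ₁).symm) + ((1 : Matrix l l ℝ) ⊗ₖ 𝔔₀) * ((c ⊗ₖ W₁).submatrix id (e₂ l ρ₂ ρ₁).symm) = 0 := by
    have h := b1; simp only [Matrix.transpose_submatrix, kronecker_transpose', hc, Matrix.transpose_one, Matrix.transpose_mul, Matrix.transpose_transpose, Matrix.sub_mul, Matrix.mul_sub, Matrix.add_mul, Matrix.mul_add, Matrix.neg_mul, Matrix.mul_neg, Matrix.smul_mul, Matrix.mul_smul, submatrix_id_mul, mul_submatrix_id, Matrix.submatrix_mul_equiv, Matrix.submatrix_submatrix, Function.comp_id, Function.id_comp, ← Matrix.mul_kronecker_mul, Matrix.one_mul, Matrix.mul_one, neg_mul, mul_neg, neg_neg, neg_kronecker_comm, add_lift, sub_lift, neg_lift, smul_lift, kron_add, kron_sub, kron_neg, kron_smul, toBlocks₁₁_lift, sub_neg_eq_add, Matrix.mul_assoc, smul_neg, neg_add_rev, fromRows_lift, fromRows_lift_zero] at h ⊢; rw [h, Matrix.kronecker_zero, Matrix.submatrix_zero];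 rfl
  have b2' : ((c * c) ⊗ₖ 𝔔₂) * (((1 : Matrix l l ℝ) ⊗ₖ W₀).submatrix id (e₂ l ρ₂ ρ₁).symm) + (2 : ℝ) • ((c ⊗ₖ 𝔔₁) * ((c ⊗ₖ W₁).submatrix id (e₂ l ρ₂ ρ₁).symm)) + ((1 : Matrix l l ℝ) ⊗ₖ 𝔔₀) * (((c * c) ⊗ₖ W₂).submatrix id (e₂ l ρ₂ ρ₁).symm) = 0 := by
    have h := b2; simp only [Matrix.transpose_submatrix, kronecker_transpose', hc, Matrix.transpose_one, Matrix.transpose_mul, Matrix.transpose_transpose, Matrix.sub_mul, Matrix.mul_sub, Matrix.add_mul, Matrix.mul_add, Matrix.neg_mul, Matrix.mul_neg, Matrix.smul_mul, Matrix.mul_smul, submatrix_id_mul, mul_submatrix_id, Matrix.submatrix_mul_equiv, Matrix.submatrix_submatrix, Function.comp_id, Function.id_comp, ← Matrix.mul_kronecker_mul, Matrix.one_mul, Matrix.mul_one, neg_mul, mul_neg, neg_neg, neg_kronecker_comm, add_lift, sub_lift, neg_lift, smul_lift, kron_add, kron_sub, kron_neg, kron_smul, toBlocks₁₁_lift, sub_neg_eq_add,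 Matrix.mul_assoc, smul_neg, neg_add_rev, fromRows_lift, fromRows_lift_zero] at h ⊢; rw [h, Matrix.kronecker_zero, Matrix.submatrix_zero]; rfl
  have hPW' : ((((1 : Matrix l l ℝ) ⊗ₖ P).submatrix (e₂ l ρ₂ ρ₁).symm id) * (((1 : Matrix l l ℝ) ⊗ₖ W₀).submatrix id (e₂ l ρ₂ ρ₁).symm)).det ≠ 0 := by
    simp only [Matrix.transpose_submatrix, kronecker_transpose', hc, Matrix.transpose_one, Matrix.transpose_mul, Matrix.transpose_transpose, Matrix.sub_mul, Matrix.mul_sub, Matrix.add_mul, Matrix.mul_add, Matrix.neg_mul, Matrix.mul_neg, Matrix.smul_mul, Matrix.mul_smul, submatrix_id_mul, mul_submatrix_id, Matrix.submatrix_mul_equiv, Matrix.submatrix_submatrix, Function.comp_id, Function.id_comp, ← Matrix.mul_kronecker_mul, Matrix.one_mul, Matrix.mul_one, neg_mul, mul_neg, neg_neg, neg_kronecker_comm, add_lift, sub_lift, neg_lift, smul_lift, kron_add, kron_sub, kron_neg, kron_smul, toBlocks₁₁_lift, sub_neg_eq_add, Matrix.mul_assoc, smul_neg, neg_add_rev,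 fromRows_lift, fromRows_lift_zero]
    rw [Matrix.det_submatrix_equiv_self]; exact det_one_kronecker_ne_zero hPW
  have hTW' : (fromRows (((1 : Matrix l l ℝ) ⊗ₖ τ₂) * ((1 : Matrix l l ℝ) ⊗ₖ Q₁₀)) ((1 : Matrix l l ℝ) ⊗ₖ τ₁) * (((1 : Matrix l l ℝ) ⊗ₖ W₀).submatrix id (e₂ l ρ₂ ρ₁).symm)).det ≠ 0 := by
    simp only [Matrix.transpose_submatrix, kronecker_transpose', hc, Matrix.transpose_one, Matrix.transpose_mul, Matrix.transpose_transpose, Matrix.sub_mul, Matrix.mul_sub, Matrix.add_mul, Matrix.mul_add, Matrix.neg_mul, Matrix.mul_neg, Matrix.smul_mul, Matrix.mul_smul, submatrix_id_mul, mul_submatrix_id, Matrix.submatrix_mul_equiv, Matrix.submatrix_submatrix, Function.comp_id, Function.id_comp, ← Matrix.mul_kronecker_mul, Matrix.one_mul, Matrix.mul_one, neg_mul, mul_neg, neg_neg, neg_kronecker_comm, add_lift, sub_lift, neg_lift, smul_lift, kron_add, kron_sub, kron_neg, kron_smul, toBlocks₁₁_lift, sub_neg_eq_add, Matrix.mul_assoc,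 smul_neg, neg_add_rev, fromRows_lift, fromRows_lift_zero]
    rw [Matrix.det_submatrix_equiv_self]; exact det_one_kronecker_ne_zero hTW
  have hΓ' : flucCov ((1 : Matrix l l ℝ) ⊗ₖ H₀) (fromRows ((1 : Matrix l l ℝ) ⊗ₖ Q₁₀) ((1 : Matrix l l ℝ) ⊗ₖ τ₁)) = ((1 : Matrix l l ℝ) ⊗ₖ Γ) := by rw [flucCov_lift, hΓ]
  have hI' : minOp ((1 : Matrix l l ℝ) ⊗ₖ H₀) (fromRows ((1 : Matrix l l ℝ) ⊗ₖ Q₁₀) ((1 : Matrix l l ℝ) ⊗ₖ τ₁)) = (((1 : Matrix l l ℝ) ⊗ₖ I)).submatrix id (e₂ l μ ρ₁).symm := by rw [minOp_lift, hI]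
  have hL' : minOpL ((1 : Matrix l l ℝ) ⊗ₖ H₀) (fromRows ((1 : Matrix l l ℝ) ⊗ₖ Q₁₀) ((1 : Matrix l l ℝ) ⊗ₖ τ₁)) = (((1 : Matrix l l ℝ) ⊗ₖ L)).submatrix (e₂ l μ ρ₁).symm id := by rw [minOpL_lift, hL]
  have hS' : effForm ((1 : Matrix l l ℝ) ⊗ₖ H₀) (fromRows ((1 : Matrix l l ℝ) ⊗ₖ Q₁₀) ((1 : Matrix l l ℝ) ⊗ₖ τ₁)) = (((1 : Matrix l l ℝ) ⊗ₖ S)).submatrix (e₂ l μ ρ₁).symm (e₂ l μ ρ₁).symm := by rw [effForm_lift, hS]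
  have hB' : fromRows (c ⊗ₖ Q₁₁) (0 : Matrix (l × ρ₁) (l × ν) ℝ) = fromRows (c ⊗ₖ Q₁₁) (0 : Matrix (l × ρ₁) (l × ν) ℝ) := rfl
  have h1' : (kkt ((1 : Matrix l l ℝ) ⊗ₖ H₀) (fromRows ((1 : Matrix l l ℝ) ⊗ₖ Q₁₀) ((1 : Matrix l l ℝ) ⊗ₖ τ₁))).det ≠ 0 := det_kkt_lift_ne_zero h1
  have h2' : (kkt (((((1 : Matrix l l ℝ) ⊗ₖ S)).submatrix (e₂ l μ ρ₁).symm (e₂ l μ ρ₁).symm).toBlocks₁₁ + ((1 : Matrix l l ℝ) ⊗ₖ G₀)) (fromRows ((1 : Matrix l l ℝ) ⊗ₖ Q₂₀) ((1 : Matrix l l ℝ) ⊗ₖ τ₂))).det ≠ 0 := by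
    rw [toBlocks₁₁_lift, kron_add]; exact det_kkt_lift_ne_zero h2
  -- the transport letters: graded congruence words, one-sided multiplier ∕ inverse ∕ unimodularity letters
  have k0' : ((1 : Matrix l l ℝ) ⊗ₖ A₀)ᵀ * ((1 : Matrix l l ℝ) ⊗ₖ 𝔎₀) * ((1 : Matrix l l ℝ) ⊗ₖ A₀) = ((1 : Matrix l l ℝ) ⊗ₖ 𝔎'₀) := by
    have h := k0; simp only [Matrix.transpose_submatrix, kronecker_transpose', hc, Matrix.transpose_one, Matrix.transpose_mul, Matrix.transpose_transpose, Matrix.sub_mul, Matrix.mul_sub, Matrix.add_mul, Matrix.mul_add, Matrix.neg_mul, Matrix.mul_neg, Matrix.smul_mul, Matrix.mul_smul, submatrix_id_mul, mul_submatrix_id, Matrix.submatrix_mul_equiv, Matrix.submatrix_submatrix, Function.comp_id, Function.id_comp, ← Matrix.mul_kronecker_mul, Matrix.one_mul, Matrix.mul_one, neg_mul, mul_neg, neg_neg, neg_kronecker_comm, add_lift, sub_lift, neg_lift, smul_lift, kron_add, kron_sub, kron_neg, kron_smul, toBlocks₁₁_lift, sub_neg_eq_add, Matrix.mul_assoc,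 smul_neg, neg_add_rev, fromRows_lift, fromRows_lift_zero] at h ⊢; rw [h]
  have k1' : (c ⊗ₖ A₁)ᵀ * ((1 : Matrix l l ℝ) ⊗ₖ 𝔎₀) * ((1 : Matrix l l ℝ) ⊗ₖ A₀) + ((1 : Matrix l l ℝ) ⊗ₖ A₀)ᵀ * (c ⊗ₖ 𝔎₁) * ((1 : Matrix l l ℝ) ⊗ₖ A₀) + ((1 : Matrix l l ℝ) ⊗ₖ A₀)ᵀ * ((1 : Matrix l l ℝ) ⊗ₖ 𝔎₀) * (c ⊗ₖ A₁) = (c ⊗ₖ 𝔎'₁) := by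
    have h := k1; simp only [Matrix.transpose_submatrix, kronecker_transpose', hc, Matrix.transpose_one, Matrix.transpose_mul, Matrix.transpose_transpose, Matrix.sub_mul, Matrix.mul_sub, Matrix.add_mul, Matrix.mul_add, Matrix.neg_mul, Matrix.mul_neg, Matrix.smul_mul, Matrix.mul_smul, submatrix_id_mul, mul_submatrix_id, Matrix.submatrix_mul_equiv, Matrix.submatrix_submatrix, Function.comp_id, Function.id_comp, ← Matrix.mul_kronecker_mul, Matrix.one_mul, Matrix.mul_one, neg_mul, mul_neg, neg_neg, neg_kronecker_comm, add_lift, sub_lift, neg_lift, smul_lift, kron_add, kron_sub, kron_neg, kron_smul, toBlocks₁₁_lift, sub_neg_eq_add, Matrix.mul_assoc, smul_neg, neg_add_rev, fromRows_lift, fromRows_lift_zero] at h ⊢; rw [h]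
  have k2' : ((c * c) ⊗ₖ A₂)ᵀ * ((1 : Matrix l l ℝ) ⊗ₖ 𝔎₀) * ((1 : Matrix l l ℝ) ⊗ₖ A₀) + ((c ⊗ₖ A₁)ᵀ * (c ⊗ₖ 𝔎₁) * ((1 : Matrix l l ℝ) ⊗ₖ A₀) + (c ⊗ₖ A₁)ᵀ * ((1 : Matrix l l ℝ) ⊗ₖ 𝔎₀) * (c ⊗ₖ A₁)) + (((c ⊗ₖ A₁)ᵀ * (c ⊗ₖ 𝔎₁) * ((1 : Matrix l l ℝ) ⊗ₖ A₀) + (c ⊗ₖ A₁)ᵀ * ((1 : Matrix l l ℝ) ⊗ₖ 𝔎₀) * (c ⊗ₖ A₁)) + (((1 : Matrix l l ℝ) ⊗ₖ A₀)ᵀ * ((c * c) ⊗ₖ 𝔎₂) * ((1 : Matrix l l ℝ) ⊗ₖ A₀) + ((1 : Matrix l l ℝ) ⊗ₖ A₀)ᵀ * (c ⊗ₖ 𝔎₁) * (c ⊗ₖ A₁) + (((1 : Matrix l l ℝ) ⊗ₖ A₀)ᵀ * (c ⊗ₖ 𝔎₁) * (c ⊗ₖ A₁) + ((1 : Matrix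 l l ℝ) ⊗ₖ A₀)ᵀ * ((1 : Matrix l l ℝ) ⊗ₖ 𝔎₀) * ((c * c) ⊗ₖ A₂)))) = ((c * c) ⊗ₖ 𝔎'₂) := by
    have h := k2; simp only [Matrix.transpose_submatrix, kronecker_transpose', hc, Matrix.transpose_one, Matrix.transpose_mul, Matrix.transpose_transpose, Matrix.sub_mul, Matrix.mul_sub, Matrix.add_mul, Matrix.mul_add, Matrix.neg_mul, Matrix.mul_neg, Matrix.smul_mul, Matrix.mul_smul, submatrix_id_mul, mul_submatrix_id, Matrix.submatrix_mul_equiv, Matrix.submatrix_submatrix, Function.comp_id, Function.id_comp, ← Matrix.mul_kronecker_mul, Matrix.one_mul, Matrix.mul_one, neg_mul, mul_neg, neg_neg, neg_kronecker_comm, add_lift, sub_lift, neg_lift, smul_lift, kron_add, kron_sub, kron_neg, kron_smul, toBlocks₁₁_lift, sub_neg_eq_add, Matrix.mul_assoc, smul_neg, neg_add_rev, fromRows_lift, fromRows_lift_zero] at h ⊢; rw [h]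
  have q0' : ((1 : Matrix l l ℝ) ⊗ₖ Ā₀) * ((1 : Matrix l l ℝ) ⊗ₖ 𝔔₀) * ((1 : Matrix l l ℝ) ⊗ₖ A₀) = ((1 : Matrix l l ℝ) ⊗ₖ 𝔔'₀) := by
    have h := q0; simp only [Matrix.transpose_submatrix, kronecker_transpose', hc, Matrix.transpose_one, Matrix.transpose_mul, Matrix.transpose_transpose, Matrix.sub_mul, Matrix.mul_sub, Matrix.add_mul, Matrix.mul_add, Matrix.neg_mul, Matrix.mul_neg, Matrix.smul_mul, Matrix.mul_smul, submatrix_id_mul, mul_submatrix_id, Matrix.submatrix_mul_equiv, Matrix.submatrix_submatrix, Function.comp_id, Function.id_comp, ← Matrix.mul_kronecker_mul, Matrix.one_mul, Matrix.mul_one, neg_mul, mul_neg, neg_neg, neg_kronecker_comm, add_lift, sub_lift, neg_lift, smul_lift, kron_add, kron_sub, kron_neg, kron_smul, toBlocks₁₁_lift, sub_neg_eq_add, Matrix.mul_assoc, smul_neg, neg_add_rev, fromRows_lift, fromRows_lift_zero] at h ⊢; rw [h]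
  have q1' : (c ⊗ₖ Ā₁) * ((1 : Matrix l l ℝ) ⊗ₖ 𝔔₀) * ((1 : Matrix l l ℝ) ⊗ₖ A₀) + ((1 : Matrix l l ℝ) ⊗ₖ Ā₀) * (c ⊗ₖ 𝔔₁) * ((1 : Matrix l l ℝ) ⊗ₖ A₀) + ((1 : Matrix l l ℝ) ⊗ₖ Ā₀) * ((1 : Matrix l l ℝ) ⊗ₖ 𝔔₀) * (c ⊗ₖ A₁) = (c ⊗ₖ 𝔔'₁) := by
    have h := q1; simp only [Matrix.transpose_submatrix, kronecker_transpose', hc, Matrix.transpose_one, Matrix.transpose_mul, Matrix.transpose_transpose, Matrix.sub_mul, Matrix.mul_sub, Matrix.add_mul, Matrix.mul_add, Matrix.neg_mul, Matrix.mul_neg, Matrix.smul_mul, Matrix.mul_smul, submatrix_id_mul, mul_submatrix_id, Matrix.submatrix_mul_equiv, Matrix.submatrix_submatrix, Function.comp_id, Function.id_comp, ← Matrix.mul_kronecker_mul, Matrix.one_mul, Matrix.mul_one, neg_mul, mul_neg, neg_neg, neg_kronecker_comm, add_lift, sub_lift, neg_lift, smul_lift, kron_add, kron_sub, kron_neg,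 kron_smul, toBlocks₁₁_lift, sub_neg_eq_add, Matrix.mul_assoc, smul_neg, neg_add_rev, fromRows_lift, fromRows_lift_zero] at h ⊢; rw [h]
  have q2' : ((c * c) ⊗ₖ Ā₂) * ((1 : Matrix l l ℝ) ⊗ₖ 𝔔₀) * ((1 : Matrix l l ℝ) ⊗ₖ A₀) + ((c ⊗ₖ Ā₁) * (c ⊗ₖ 𝔔₁) * ((1 : Matrix l l ℝ) ⊗ₖ A₀) + (c ⊗ₖ Ā₁) * ((1 : Matrix l l ℝ) ⊗ₖ 𝔔₀) * (c ⊗ₖ A₁)) + (((c ⊗ₖ Ā₁) * (c ⊗ₖ 𝔔₁) * ((1 : Matrix l l ℝ) ⊗ₖ A₀) + (c ⊗ₖ Ā₁) * ((1 : Matrix l l ℝ) ⊗ₖ 𝔔₀) * (c ⊗ₖ A₁)) + (((1 : Matrix l l ℝ) ⊗ₖ Ā₀) * ((c * c) ⊗ₖ 𝔔₂) * ((1 : Matrix l l ℝ) ⊗ₖ A₀) + ((1 : Matrix l l ℝ) ⊗ₖ Ā₀) * (c ⊗ₖ 𝔔₁) * (c ⊗ₖ A₁) + (((1 : Matrix l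 l ℝ) ⊗ₖ Ā₀) * (c ⊗ₖ 𝔔₁) * (c ⊗ₖ A₁) + ((1 : Matrix l l ℝ) ⊗ₖ Ā₀) * ((1 : Matrix l l ℝ) ⊗ₖ 𝔔₀) * ((c * c) ⊗ₖ A₂)))) = ((c * c) ⊗ₖ 𝔔'₂) := by
    have h := q2; simp only [Matrix.transpose_submatrix, kronecker_transpose', hc, Matrix.transpose_one, Matrix.transpose_mul, Matrix.transpose_transpose, Matrix.sub_mul, Matrix.mul_sub, Matrix.add_mul, Matrix.mul_add, Matrix.neg_mul, Matrix.mul_neg, Matrix.smul_mul, Matrix.mul_smul, submatrix_id_mul, mul_submatrix_id, Matrix.submatrix_mul_equiv, Matrix.submatrix_submatrix, Function.comp_id, Function.id_comp, ← Matrix.mul_kronecker_mul, Matrix.one_mul, Matrix.mul_one, neg_mul, mul_neg, neg_neg, neg_kronecker_comm, add_lift, sub_lift, neg_lift, smul_lift, kron_add, kron_sub, kron_neg, kron_smul, toBlocks₁₁_lift, sub_neg_eq_add, Matrix.mul_assoc, smul_neg, neg_add_rev, fromRows_lift, fromRows_lift_zero] at h ⊢; rw [h]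
  have hA' : ((1 : Matrix l l ℝ) ⊗ₖ A₀).det ≠ 0 := det_one_kronecker_ne_zero hA
  have hĀ' : ((1 : Matrix l l ℝ) ⊗ₖ Ā₀).det ≠ 0 := det_one_kronecker_ne_zero hĀ
  have i0' : ((1 : Matrix l l ℝ) ⊗ₖ A'₀) * ((1 : Matrix l l ℝ) ⊗ₖ A₀) = 1 := by rw [← Matrix.mul_kronecker_mul, Matrix.one_mul, i0, Matrix.one_kronecker_one]
  have i1' : (c ⊗ₖ A'₁) * ((1 : Matrix l l ℝ) ⊗ₖ A₀) + ((1 : Matrix l l ℝ) ⊗ₖ A'₀) * (c ⊗ₖ A₁) = 0 := by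
    have h := i1; simp only [Matrix.transpose_submatrix, kronecker_transpose', hc, Matrix.transpose_one, Matrix.transpose_mul, Matrix.transpose_transpose, Matrix.sub_mul, Matrix.mul_sub, Matrix.add_mul, Matrix.mul_add, Matrix.neg_mul, Matrix.mul_neg, Matrix.smul_mul, Matrix.mul_smul, submatrix_id_mul, mul_submatrix_id, Matrix.submatrix_mul_equiv, Matrix.submatrix_submatrix, Function.comp_id, Function.id_comp, ← Matrix.mul_kronecker_mul, Matrix.one_mul, Matrix.mul_one, neg_mul, mul_neg, neg_neg, neg_kronecker_comm, add_lift, sub_lift, neg_lift, smul_lift, kron_add, kron_sub, kron_neg, kron_smul, toBlocks₁₁_lift, sub_neg_eq_add, Matrix.mul_assoc, smul_neg, neg_add_rev, fromRows_lift, fromRows_lift_zero] at h ⊢; rw [h, Matrix.kronecker_zero]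
  have i2' : ((c * c) ⊗ₖ A'₂) * ((1 : Matrix l l ℝ) ⊗ₖ A₀) + (2 : ℝ) • ((c ⊗ₖ A'₁) * (c ⊗ₖ A₁)) + ((1 : Matrix l l ℝ) ⊗ₖ A'₀) * ((c * c) ⊗ₖ A₂) = 0 := by
    have h := i2; simp only [Matrix.transpose_submatrix, kronecker_transpose', hc, Matrix.transpose_one, Matrix.transpose_mul, Matrix.transpose_transpose, Matrix.sub_mul, Matrix.mul_sub, Matrix.add_mul, Matrix.mul_add, Matrix.neg_mul, Matrix.mul_neg, Matrix.smul_mul, Matrix.mul_smul, submatrix_id_mul, mul_submatrix_id, Matrix.submatrix_mul_equiv, Matrix.submatrix_submatrix, Function.comp_id, Function.id_comp, ← Matrix.mul_kronecker_mul, Matrix.one_mul, Matrix.mul_one, neg_mul, mul_neg, neg_neg, neg_kronecker_comm, add_lift, sub_lift, neg_lift, smul_lift, kron_add, kron_sub, kron_neg, kron_smul, toBlocks₁₁_lift, sub_neg_eq_add, Matrix.mul_assoc, smul_neg, neg_add_rev, fromRows_lift, fromRows_lift_zero] at h ⊢; rw [h, Matrix.kronecker_zero]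
  have uA' : secondVar ((1 : Matrix l l ℝ) ⊗ₖ A₀) (c ⊗ₖ A₁) ((c * c) ⊗ₖ A₂) = 0 := by rw [secondVar_kronecker_lift, uA, mul_zero]
  have uĀ' : secondVar ((1 : Matrix l l ℝ) ⊗ₖ Ā₀) (c ⊗ₖ Ā₁) ((c * c) ⊗ₖ Ā₂) = 0 := by rw [secondVar_kronecker_lift, uĀ, mul_zero]
  have hPAW' : ((((1 : Matrix l l ℝ) ⊗ₖ P).submatrix (e₂ l ρ₂ ρ₁).symm id) * ((1 : Matrix l l ℝ) ⊗ₖ A'₀) * (((1 : Matrix l l ℝ) ⊗ₖ W₀).submatrix id (e₂ l ρ₂ ρ₁).symm)).det ≠ 0 := by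
    have h := hPAW; simp only [Matrix.transpose_submatrix, kronecker_transpose', hc, Matrix.transpose_one, Matrix.transpose_mul, Matrix.transpose_transpose, Matrix.sub_mul, Matrix.mul_sub, Matrix.add_mul, Matrix.mul_add, Matrix.neg_mul, Matrix.mul_neg, Matrix.smul_mul, Matrix.mul_smul, submatrix_id_mul, mul_submatrix_id, Matrix.submatrix_mul_equiv, Matrix.submatrix_submatrix, Function.comp_id, Function.id_comp, ← Matrix.mul_kronecker_mul, Matrix.one_mul, Matrix.mul_one, neg_mul, mul_neg, neg_neg, neg_kronecker_comm, add_lift, sub_lift, neg_lift, smul_lift, kron_add, kron_sub, kron_neg, kron_smul, toBlocks₁₁_lift, sub_neg_eq_add, Matrix.mul_assoc, smul_neg, neg_add_rev, fromRows_lift, fromRows_lift_zero] at h ⊢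
    rw [Matrix.det_submatrix_equiv_self]; exact det_one_kronecker_ne_zero h
  -- (2) S1 §1 at the lifted objects
  have main := secondVar_oneShot_nestedStepLaw_transported ((1 : Matrix l l ℝ) ⊗ₖ H₀) (c ⊗ₖ H₁) ((c * c) ⊗ₖ H₂) ((1 : Matrix l l ℝ) ⊗ₖ Q₁₀) (c ⊗ₖ Q₁₁) ((c * c) ⊗ₖ Q₁₂) ((1 : Matrix l l ℝ) ⊗ₖ Q₂₀) (c ⊗ₖ Q₂₁) ((c * c) ⊗ₖ Q₂₂) ((1 : Matrix l l ℝ) ⊗ₖ G₀) (c ⊗ₖ G₁) ((c * c) ⊗ₖ G₂) ((1 : Matrix l l ℝ) ⊗ₖ τ₁) ((1 : Matrix l l ℝ) ⊗ₖ τ₂) (((1 : Matrix l l ℝ) ⊗ₖ P).submatrix (e₂ l ρ₂ ρ₁).symm id) (((1 : Matrix l l ℝ) ⊗ₖ W₀).submatrix id (e₂ l ρ₂ ρ₁).symm) ((c ⊗ₖ W₁).submatrix id (e₂ l ρ₂ ρ₁).symm) (((c * c) ⊗ₖ W₂).submatrix id (e₂ l ρ₂ ρ₁).symm) (((1 : Matrix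 l l ℝ) ⊗ₖ Y₀).submatrix id (e₂ l ρ₂ ρ₁).symm) ((c ⊗ₖ Y₁).submatrix id (e₂ l ρ₂ ρ₁).symm) (((c * c) ⊗ₖ Y₂).submatrix id (e₂ l ρ₂ ρ₁).symm) (((1 : Matrix l l ℝ) ⊗ₖ Y₀).submatrix id (e₂ l ρ₂ ρ₁).symm) ((c ⊗ₖ Y₁).submatrix id (e₂ l ρ₂ ρ₁).symm) (((c * c) ⊗ₖ Y₂).submatrix id (e₂ l ρ₂ ρ₁).symm) ((1 : Matrix l l ℝ) ⊗ₖ A₀) (c ⊗ₖ A₁) ((c * c) ⊗ₖ A₂) ((1 : Matrix l l ℝ) ⊗ₖ A'₀) (c ⊗ₖ A'₁) ((c * c) ⊗ₖ A'₂) ((1 : Matrix l l ℝ) ⊗ₖ Ā₀) (c ⊗ₖ Ā₁) ((c * c) ⊗ₖ Ā₂)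
    h𝔎₀' h𝔎₁' h𝔎₂' h𝔔₀' h𝔔₁' h𝔔₂' k0' k1' k2' q0' q1' q2' hA' hĀ' i0' i1' i2' uA' uĀ' a0' a1' a2' a0t' a1t' a2t' b0' b1' b2' hPW' hTW' hPAW'
    hΓ' hI' hL' hS' hB' h1' h2'
  -- (3) strip back: the coarse form blocks are lifts of the GRADED stripped words
  have e0 : ((((1 : Matrix l l ℝ) ⊗ₖ S).submatrix (e₂ l μ ρ₁).symm (e₂ l μ ρ₁).symm).toBlocks₁₁ + ((1 : Matrix l l ℝ) ⊗ₖ G₀)) = (1 : Matrix l l ℝ) ⊗ₖ (S.toBlocks₁₁ + G₀) := by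
    rw [toBlocks₁₁_lift, kron_add]
  have e1 : ((((((1 : Matrix l l ℝ) ⊗ₖ L).submatrix (e₂ l μ ρ₁).symm id) * (c ⊗ₖ H₁) - (((1 : Matrix l l ℝ) ⊗ₖ S).submatrix (e₂ l μ ρ₁).symm (e₂ l μ ρ₁).symm) * (fromRows (c ⊗ₖ Q₁₁) (0 : Matrix (l × ρ₁) (l × ν) ℝ))) * (((1 : Matrix l l ℝ) ⊗ₖ I).submatrix id (e₂ l μ ρ₁).symm) - (((1 : Matrix l l ℝ) ⊗ₖ L).submatrix (e₂ l μ ρ₁).symm id) * (fromRows (c ⊗ₖ Q₁₁) (0 : Matrix (l × ρ₁) (l × ν) ℝ))ᵀ * (((1 : Matrix l l ℝ) ⊗ₖ S).submatrix (e₂ l μ ρ₁).symm (e₂ l μ ρ₁).symm)).toBlocks₁₁ + (c ⊗ₖ G₁)) = c ⊗ₖ (((L * H₁ - S * (fromRows Q₁₁ (0 : Matrix ρ₁ ν ℝ))) * I + L * (fromRows Q₁₁ (0 : Matrix ρ₁ ν ℝ))ᵀ * S).toBlocks₁₁ + G₁) := by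
    simp only [Matrix.transpose_submatrix, kronecker_transpose', hc, Matrix.transpose_one, Matrix.transpose_mul, Matrix.transpose_transpose, Matrix.sub_mul, Matrix.mul_sub, Matrix.add_mul, Matrix.mul_add, Matrix.neg_mul, Matrix.mul_neg, Matrix.smul_mul, Matrix.mul_smul, submatrix_id_mul, mul_submatrix_id, Matrix.submatrix_mul_equiv, Matrix.submatrix_submatrix, Function.comp_id, Function.id_comp, ← Matrix.mul_kronecker_mul, Matrix.one_mul, Matrix.mul_one, neg_mul, mul_neg, neg_neg, neg_kronecker_comm, add_lift, sub_lift, neg_lift, smul_lift, kron_add, kron_sub, kron_neg, kron_smul, toBlocks₁₁_lift, sub_neg_eq_add, Matrix.mul_assoc, smul_neg, neg_add_rev, fromRows_lift, fromRows_lift_zero]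
  have e2 : ((((-(((((1 : Matrix l l ℝ) ⊗ₖ L).submatrix (e₂ l μ ρ₁).symm id) * (c ⊗ₖ H₁) - (((1 : Matrix l l ℝ) ⊗ₖ S).submatrix (e₂ l μ ρ₁).symm (e₂ l μ ρ₁).symm) * (fromRows (c ⊗ₖ Q₁₁) (0 : Matrix (l × ρ₁) (l × ν) ℝ))) * ((1 : Matrix l l ℝ) ⊗ₖ Γ) + (((1 : Matrix l l ℝ) ⊗ₖ L).submatrix (e₂ l μ ρ₁).symm id) * (fromRows (c ⊗ₖ Q₁₁) (0 : Matrix (l × ρ₁) (l × ν) ℝ))ᵀ * (((1 : Matrix l l ℝ) ⊗ₖ L).submatrix (e₂ l μ ρ₁).symm id)) * (c ⊗ₖ H₁) + (((1 : Matrix l l ℝ) ⊗ₖ L).submatrix (e₂ l μ ρ₁).symm id) * ((c * c) ⊗ₖ H₂) - ((((((1 : Matrix l l ℝ) ⊗ₖ L).submatrix (e₂ l μ ρ₁).symm id) * (c ⊗ₖ H₁) - (((1 : Matrix l l ℝ) ⊗ₖ S).submatrix (e₂ l μ ρ₁).symm (e₂ l μ ρ₁).symm) * (fromRows (c ⊗ₖ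 Q₁₁) (0 : Matrix (l × ρ₁) (l × ν) ℝ))) * (((1 : Matrix l l ℝ) ⊗ₖ I).submatrix id (e₂ l μ ρ₁).symm) - (((1 : Matrix l l ℝ) ⊗ₖ L).submatrix (e₂ l μ ρ₁).symm id) * (fromRows (c ⊗ₖ Q₁₁) (0 : Matrix (l × ρ₁) (l × ν) ℝ))ᵀ * (((1 : Matrix l l ℝ) ⊗ₖ S).submatrix (e₂ l μ ρ₁).symm (e₂ l μ ρ₁).symm)) * (fromRows (c ⊗ₖ Q₁₁) (0 : Matrix (l × ρ₁) (l × ν) ℝ)) + (((1 : Matrix l l ℝ) ⊗ₖ S).submatrix (e₂ l μ ρ₁).symm (e₂ l μ ρ₁).symm) * (fromRows ((c * c) ⊗ₖ Q₁₂) (0 : Matrix (l × ρ₁) (l × ν) ℝ)))) * (((1 : Matrix l l ℝ) ⊗ₖ I).submatrix id (e₂ l μ ρ₁).symm) + ((((1 : Matrix l l ℝ) ⊗ₖ L).submatrix (e₂ l μ ρ₁).symm id) * (c ⊗ₖ H₁) - (((1 : Matrix l l ℝ) ⊗ₖ S).submatrix (e₂ l μ ρ₁).symm (e₂ l μ ρ₁).symm)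 * (fromRows (c ⊗ₖ Q₁₁) (0 : Matrix (l × ρ₁) (l × ν) ℝ))) * (-((((1 : Matrix l l ℝ) ⊗ₖ Γ) * (c ⊗ₖ H₁) + (((1 : Matrix l l ℝ) ⊗ₖ I).submatrix id (e₂ l μ ρ₁).symm) * (fromRows (c ⊗ₖ Q₁₁) (0 : Matrix (l × ρ₁) (l × ν) ℝ))) * (((1 : Matrix l l ℝ) ⊗ₖ I).submatrix id (e₂ l μ ρ₁).symm) - ((1 : Matrix l l ℝ) ⊗ₖ Γ) * (fromRows (c ⊗ₖ Q₁₁) (0 : Matrix (l × ρ₁) (l × ν) ℝ))ᵀ * (((1 : Matrix l l ℝ) ⊗ₖ S).submatrix (e₂ l μ ρ₁).symm (e₂ l μ ρ₁).symm)))) - ((-(((((1 : Matrix l l ℝ) ⊗ₖ L).submatrix (e₂ l μ ρ₁).symm id) * (c ⊗ₖ H₁) - (((1 : Matrix l l ℝ) ⊗ₖ S).submatrix (e₂ l μ ρ₁).symm (e₂ l μ ρ₁).symm) * (fromRows (c ⊗ₖ Q₁₁) (0 : Matrix (l × ρ₁) (l × ν) ℝ))) * ((1 : Matrix l l ℝ)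 ⊗ₖ Γ) + (((1 : Matrix l l ℝ) ⊗ₖ L).submatrix (e₂ l μ ρ₁).symm id) * (fromRows (c ⊗ₖ Q₁₁) (0 : Matrix (l × ρ₁) (l × ν) ℝ))ᵀ * (((1 : Matrix l l ℝ) ⊗ₖ L).submatrix (e₂ l μ ρ₁).symm id)) * (fromRows (c ⊗ₖ Q₁₁) (0 : Matrix (l × ρ₁) (l × ν) ℝ))ᵀ + (((1 : Matrix l l ℝ) ⊗ₖ L).submatrix (e₂ l μ ρ₁).symm id) * ((fromRows ((c * c) ⊗ₖ Q₁₂) (0 : Matrix (l × ρ₁) (l × ν) ℝ)))ᵀ) * (((1 : Matrix l l ℝ) ⊗ₖ S).submatrix (e₂ l μ ρ₁).symm (e₂ l μ ρ₁).symm) + (((1 : Matrix l l ℝ) ⊗ₖ L).submatrix (e₂ l μ ρ₁).symm id) * (fromRows (c ⊗ₖ Q₁₁) (0 : Matrix (l × ρ₁) (l × ν) ℝ))ᵀ * (((((1 : Matrix l l ℝ) ⊗ₖ L).submatrix (e₂ l μ ρ₁).symm id) * (c ⊗ₖ H₁) - (((1 : Matrix l l ℝ) ⊗ₖ S).submatrix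 (e₂ l μ ρ₁).symm (e₂ l μ ρ₁).symm) * (fromRows (c ⊗ₖ Q₁₁) (0 : Matrix (l × ρ₁) (l × ν) ℝ))) * (((1 : Matrix l l ℝ) ⊗ₖ I).submatrix id (e₂ l μ ρ₁).symm) - (((1 : Matrix l l ℝ) ⊗ₖ L).submatrix (e₂ l μ ρ₁).symm id) * (fromRows (c ⊗ₖ Q₁₁) (0 : Matrix (l × ρ₁) (l × ν) ℝ))ᵀ * (((1 : Matrix l l ℝ) ⊗ₖ S).submatrix (e₂ l μ ρ₁).symm (e₂ l μ ρ₁).symm)))).toBlocks₁₁ + ((c * c) ⊗ₖ G₂)) = (c * c) ⊗ₖ ((((-((L * H₁ - S * (fromRows Q₁₁ (0 : Matrix ρ₁ ν ℝ))) * Γ - L * (fromRows Q₁₁ (0 : Matrix ρ₁ ν ℝ))ᵀ * L) * H₁ + L * H₂ - (((L * H₁ - S * (fromRows Q₁₁ (0 : Matrix ρ₁ ν ℝ))) * I + L * (fromRows Q₁₁ (0 : Matrix ρ₁ ν ℝ))ᵀ * S) * (fromRows Q₁₁ (0 : Matrix ρ₁ ν ℝ)) + S * fromRows Q₁₂ (0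 : Matrix ρ₁ ν ℝ))) * I + (L * H₁ - S * (fromRows Q₁₁ (0 : Matrix ρ₁ ν ℝ))) * (-((Γ * H₁ + I * (fromRows Q₁₁ (0 : Matrix ρ₁ ν ℝ))) * I + Γ * (fromRows Q₁₁ (0 : Matrix ρ₁ ν ℝ))ᵀ * S))) - ((-((L * H₁ - S * (fromRows Q₁₁ (0 : Matrix ρ₁ ν ℝ))) * Γ - L * (fromRows Q₁₁ (0 : Matrix ρ₁ ν ℝ))ᵀ * L) * (-(fromRows Q₁₁ (0 : Matrix ρ₁ ν ℝ))ᵀ) + L * (fromRows Q₁₂ (0 : Matrix ρ₁ ν ℝ))ᵀ) * S + L * (-(fromRows Q₁₁ (0 : Matrix ρ₁ ν ℝ))ᵀ) * ((L * H₁ - S * (fromRows Q₁₁ (0 : Matrix ρ₁ ν ℝ))) * I + L * (fromRows Q₁₁ (0 : Matrix ρ₁ ν ℝ))ᵀ * S))).toBlocks₁₁ + G₂) := by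
    simp only [Matrix.transpose_submatrix, kronecker_transpose', hc, Matrix.transpose_one, Matrix.transpose_mul, Matrix.transpose_transpose, Matrix.sub_mul, Matrix.mul_sub, Matrix.add_mul, Matrix.mul_add, Matrix.neg_mul, Matrix.mul_neg, Matrix.smul_mul, Matrix.mul_smul, submatrix_id_mul, mul_submatrix_id, Matrix.submatrix_mul_equiv, Matrix.submatrix_submatrix, Function.comp_id, Function.id_comp, ← Matrix.mul_kronecker_mul, Matrix.one_mul, Matrix.mul_one, neg_mul, mul_neg, neg_neg, neg_kronecker_comm, add_lift, sub_lift, neg_lift, smul_lift, kron_add, kron_sub, kron_neg, kron_smul, toBlocks₁₁_lift, sub_neg_eq_add, Matrix.mul_assoc, smul_neg, neg_add_rev, fromRows_lift, fromRows_lift_zero]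
    congr 3
    abel
  rw [e0, e1, e2] at main
  -- the Faddeev–Popov 2-jets are re-indexed lifts (plain products: grading-blind)
  have f0 : (((1 : Matrix l l ℝ) ⊗ₖ P).submatrix (e₂ l ρ₂ ρ₁).symm id) * ((1 : Matrix l l ℝ) ⊗ₖ A'₀) * (((1 : Matrix l l ℝ) ⊗ₖ W₀).submatrix id (e₂ l ρ₂ ρ₁).symm) = ((1 : Matrix l l ℝ) ⊗ₖ (P * A'₀ * W₀)).submatrix (e₂ l ρ₂ ρ₁).symm (e₂ l ρ₂ ρ₁).symm := by
    simp only [Matrix.transpose_submatrix, kronecker_transpose', hc, Matrix.transpose_one, Matrix.transpose_mul, Matrix.transpose_transpose, Matrix.sub_mul, Matrix.mul_sub, Matrix.add_mul, Matrix.mul_add, Matrix.neg_mul, Matrix.mul_neg, Matrix.smul_mul, Matrix.mul_smul, submatrix_id_mul, mul_submatrix_id, Matrix.submatrix_mul_equiv, Matrix.submatrix_submatrix, Function.comp_id, Function.id_comp, ← Matrix.mul_kronecker_mul, Matrix.one_mul, Matrix.mul_one, neg_mul, mul_neg, neg_neg, neg_kronecker_comm, add_lift, sub_lift, neg_lift,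 smul_lift, kron_add, kron_sub, kron_neg, kron_smul, toBlocks₁₁_lift, sub_neg_eq_add, Matrix.mul_assoc, smul_neg, neg_add_rev, fromRows_lift, fromRows_lift_zero]
  have f1 : (((1 : Matrix l l ℝ) ⊗ₖ P).submatrix (e₂ l ρ₂ ρ₁).symm id) * (c ⊗ₖ A'₁) * (((1 : Matrix l l ℝ) ⊗ₖ W₀).submatrix id (e₂ l ρ₂ ρ₁).symm) + (((1 : Matrix l l ℝ) ⊗ₖ P).submatrix (e₂ l ρ₂ ρ₁).symm id) * ((1 : Matrix l l ℝ) ⊗ₖ A'₀) * ((c ⊗ₖ W₁).submatrix id (e₂ l ρ₂ ρ₁).symm) = (c ⊗ₖ (P * A'₁ * W₀ + P * A'₀ * W₁)).submatrix (e₂ l ρ₂ ρ₁).symm (e₂ l ρ₂ ρ₁).symm := by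
    simp only [Matrix.transpose_submatrix, kronecker_transpose', hc, Matrix.transpose_one, Matrix.transpose_mul, Matrix.transpose_transpose, Matrix.sub_mul, Matrix.mul_sub, Matrix.add_mul, Matrix.mul_add, Matrix.neg_mul, Matrix.mul_neg, Matrix.smul_mul, Matrix.mul_smul, submatrix_id_mul, mul_submatrix_id, Matrix.submatrix_mul_equiv, Matrix.submatrix_submatrix, Function.comp_id, Function.id_comp, ← Matrix.mul_kronecker_mul, Matrix.one_mul, Matrix.mul_one, neg_mul, mul_neg, neg_neg, neg_kronecker_comm, add_lift, sub_lift, neg_lift, smul_lift, kron_add, kron_sub, kron_neg, kron_smul, toBlocks₁₁_lift, sub_neg_eq_add, Matrix.mul_assoc, smul_neg, neg_add_rev, fromRows_lift, fromRows_lift_zero]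
  have f2 : (((1 : Matrix l l ℝ) ⊗ₖ P).submatrix (e₂ l ρ₂ ρ₁).symm id) * ((c * c) ⊗ₖ A'₂) * (((1 : Matrix l l ℝ) ⊗ₖ W₀).submatrix id (e₂ l ρ₂ ρ₁).symm) + (((1 : Matrix l l ℝ) ⊗ₖ P).submatrix (e₂ l ρ₂ ρ₁).symm id) * (c ⊗ₖ A'₁) * ((c ⊗ₖ W₁).submatrix id (e₂ l ρ₂ ρ₁).symm) + ((((1 : Matrix l l ℝ) ⊗ₖ P).submatrix (e₂ l ρ₂ ρ₁).symm id) * (c ⊗ₖ A'₁) * ((c ⊗ₖ W₁).submatrix id (e₂ l ρ₂ ρ₁).symm) + (((1 : Matrix l l ℝ) ⊗ₖ P).submatrix (e₂ l ρ₂ ρ₁).symm id) * ((1 : Matrix l l ℝ) ⊗ₖ A'₀) * (((c * c) ⊗ₖ W₂).submatrix id (e₂ l ρ₂ ρ₁).symm)) = ((c * c) ⊗ₖ (P * A'₂ * W₀ + P * A'₁ * W₁ + (P * A'₁ * W₁ + P * A'₀ * W₂))).submatrix (e₂ l ρ₂ ρ₁).symm (e₂ l ρ₂ ρ₁).symm :=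 by
    simp only [Matrix.transpose_submatrix, kronecker_transpose', hc, Matrix.transpose_one, Matrix.transpose_mul, Matrix.transpose_transpose, Matrix.sub_mul, Matrix.mul_sub, Matrix.add_mul, Matrix.mul_add, Matrix.neg_mul, Matrix.mul_neg, Matrix.smul_mul, Matrix.mul_smul, submatrix_id_mul, mul_submatrix_id, Matrix.submatrix_mul_equiv, Matrix.submatrix_submatrix, Function.comp_id, Function.id_comp, ← Matrix.mul_kronecker_mul, Matrix.one_mul, Matrix.mul_one, neg_mul, mul_neg, neg_neg, neg_kronecker_comm, add_lift, sub_lift, neg_lift, smul_lift, kron_add, kron_sub, kron_neg, kron_smul, toBlocks₁₁_lift, sub_neg_eq_add, Matrix.mul_assoc, smul_neg, neg_add_rev, fromRows_lift, fromRows_lift_zero]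
  have g0 : fromRows (((1 : Matrix l l ℝ) ⊗ₖ τ₂) * ((1 : Matrix l l ℝ) ⊗ₖ Q₁₀)) ((1 : Matrix l l ℝ) ⊗ₖ τ₁) * (((1 : Matrix l l ℝ) ⊗ₖ W₀).submatrix id (e₂ l ρ₂ ρ₁).symm) = ((1 : Matrix l l ℝ) ⊗ₖ (fromRows (τ₂ * Q₁₀) τ₁ * W₀)).submatrix (e₂ l ρ₂ ρ₁).symm (e₂ l ρ₂ ρ₁).symm := by
    simp only [Matrix.transpose_submatrix, kronecker_transpose', hc, Matrix.transpose_one, Matrix.transpose_mul, Matrix.transpose_transpose, Matrix.sub_mul, Matrix.mul_sub, Matrix.add_mul, Matrix.mul_add, Matrix.neg_mul, Matrix.mul_neg, Matrix.smul_mul, Matrix.mul_smul, submatrix_id_mul, mul_submatrix_id, Matrix.submatrix_mul_equiv, Matrix.submatrix_submatrix, Function.comp_id, Function.id_comp, ← Matrix.mul_kronecker_mul, Matrix.one_mul, Matrix.mul_one, neg_mul, mul_neg, neg_neg, neg_kronecker_comm, add_lift, sub_lift, neg_lift, smul_lift, kron_add, kron_sub, kron_neg, kron_smul, toBlocks₁₁_lift,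 sub_neg_eq_add, Matrix.mul_assoc, smul_neg, neg_add_rev, fromRows_lift, fromRows_lift_zero]
  have g1 : fromRows (((1 : Matrix l l ℝ) ⊗ₖ τ₂) * (c ⊗ₖ Q₁₁)) (0 : Matrix (l × ρ₁) (l × ν) ℝ) * (((1 : Matrix l l ℝ) ⊗ₖ W₀).submatrix id (e₂ l ρ₂ ρ₁).symm) + fromRows (((1 : Matrix l l ℝ) ⊗ₖ τ₂) * ((1 : Matrix l l ℝ) ⊗ₖ Q₁₀)) ((1 : Matrix l l ℝ) ⊗ₖ τ₁) * ((c ⊗ₖ W₁).submatrix id (e₂ l ρ₂ ρ₁).symm) = (c ⊗ₖ (fromRows (τ₂ * Q₁₁) (0 : Matrix ρ₁ ν ℝ) * W₀ + fromRows (τ₂ * Q₁₀) τ₁ * W₁)).submatrix (e₂ l ρ₂ ρ₁).symm (e₂ l ρ₂ ρ₁).symm := by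
    simp only [Matrix.transpose_submatrix, kronecker_transpose', hc, Matrix.transpose_one, Matrix.transpose_mul, Matrix.transpose_transpose, Matrix.sub_mul, Matrix.mul_sub, Matrix.add_mul, Matrix.mul_add, Matrix.neg_mul, Matrix.mul_neg, Matrix.smul_mul, Matrix.mul_smul, submatrix_id_mul, mul_submatrix_id, Matrix.submatrix_mul_equiv, Matrix.submatrix_submatrix, Function.comp_id, Function.id_comp, ← Matrix.mul_kronecker_mul, Matrix.one_mul, Matrix.mul_one, neg_mul, mul_neg, neg_neg, neg_kronecker_comm, add_lift, sub_lift, neg_lift, smul_lift, kron_add, kron_sub, kron_neg, kron_smul, toBlocks₁₁_lift, sub_neg_eq_add, Matrix.mul_assoc, smul_neg, neg_add_rev, fromRows_lift, fromRows_lift_zero]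
  have g2 : fromRows (((1 : Matrix l l ℝ) ⊗ₖ τ₂) * ((c * c) ⊗ₖ Q₁₂)) (0 : Matrix (l × ρ₁) (l × ν) ℝ) * (((1 : Matrix l l ℝ) ⊗ₖ W₀).submatrix id (e₂ l ρ₂ ρ₁).symm) + fromRows (((1 : Matrix l l ℝ) ⊗ₖ τ₂) * (c ⊗ₖ Q₁₁)) (0 : Matrix (l × ρ₁) (l × ν) ℝ) * ((c ⊗ₖ W₁).submatrix id (e₂ l ρ₂ ρ₁).symm) + (fromRows (((1 : Matrix l l ℝ) ⊗ₖ τ₂) * (c ⊗ₖ Q₁₁)) (0 : Matrix (l × ρ₁) (l × ν) ℝ) * ((c ⊗ₖ W₁).submatrix id (e₂ l ρ₂ ρ₁).symm) + fromRows (((1 : Matrix l l ℝ) ⊗ₖ τ₂) * ((1 : Matrix l l ℝ) ⊗ₖ Q₁₀)) ((1 : Matrix l l ℝ) ⊗ₖ τ₁) * (((c * c) ⊗ₖ W₂).submatrix id (e₂ l ρ₂ ρ₁).symm))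
      = ((c * c) ⊗ₖ (fromRows (τ₂ * Q₁₂) (0 : Matrix ρ₁ ν ℝ) * W₀ + fromRows (τ₂ * Q₁₁) (0 : Matrix ρ₁ ν ℝ) * W₁ + (fromRows (τ₂ * Q₁₁) (0 : Matrix ρ₁ ν ℝ) * W₁ + fromRows (τ₂ * Q₁₀) τ₁ * W₂))).submatrix (e₂ l ρ₂ ρ₁).symm (e₂ l ρ₂ ρ₁).symm := by
    simp only [Matrix.transpose_submatrix, kronecker_transpose', hc, Matrix.transpose_one, Matrix.transpose_mul, Matrix.transpose_transpose, Matrix.sub_mul, Matrix.mul_sub, Matrix.add_mul, Matrix.mul_add, Matrix.neg_mul, Matrix.mul_neg, Matrix.smul_mul, Matrix.mul_smul, submatrix_id_mul, mul_submatrix_id, Matrix.submatrix_mul_equiv, Matrix.submatrix_submatrix, Function.comp_id, Function.id_comp, ← Matrix.mul_kronecker_mul, Matrix.one_mul, Matrix.mul_one, neg_mul, mul_neg, neg_neg, neg_kronecker_comm, add_lift, sub_lift, neg_lift, smul_lift, kron_add, kron_sub, kron_neg, kron_smul, toBlocks₁₁_lift, sub_neg_eq_add, Matrix.mul_assoc,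 smul_neg, neg_add_rev, fromRows_lift, fromRows_lift_zero]
  rw [f0, f1, f2, g0, g1, g2, secondVar_submatrix_equiv, secondVar_submatrix_equiv, secondVar_kronecker_lift, secondVar_kronecker_lift] at main
  -- the one-shot system: common re-indexing of the parameter rows, then strip; the fine and coarse systems strip directly
  have z0 : (0 : Matrix ((l × ρ₂) ⊕ (l × ρ₁)) (l × ν) ℝ) = (0 : Matrix (l × (ρ₂ ⊕ ρ₁)) (l × ν) ℝ).submatrix (e₂ l ρ₂ ρ₁).symm id := rfl
  rw [z0, kkt_fromRows_submatrix, kkt_fromRows_submatrix, kkt_fromRows_submatrix, secondVar_submatrix_equiv,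
    secondVar_kkt_lift_strip_zeroSlice hc, secondVar_kkt_lift_strip_zeroSlice hc, secondVar_kkt_lift_strip_zeroSlice hc] at main
  refine mul_left_cancel₀ htr ?_
  linear_combination main

/-! ## §2 Under the intertwining letter and the chart-native (UNI)-jet ∕ dead-row letters: ZERO defect (S1's helpers BY NAME) -/

/-- [folklore] **THE GRADED TRANSPORTED LAW UNDER THE CHART-NATIVE (UNI)-JET LETTERS: ZERO DEFECT.**  As §1, with the moved-slice non-degeneracy REPLACED
by the one-shot chart's (`det(P·W♯₀) ≠ 0`, `det C₀ ≠ 0`) and in addition (T-β-4) the intertwining letter `(A′·W)ₙ = (W♯·C)ₙ`, `secondVar C-jets = 0`,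
and the two (UNI)-jet letters `uP' : secondVar (P·W♯)-jets = 0` (one-shot chart — dead rows, `ForestTriangularJets`, or `TorusOneShotFPExponential`) and
`uT : secondVar ([τ₂Q₁;τ₁]·W)-jets = 0` (nested chart).  These letters are plain products: the grading does not touch them. -/
theorem secondVar_oneShot_nestedStepLaw_transported_graded_of_uni
    (c : Matrix l l ℝ) (hc : cᵀ = -c) (htr : (c * c).trace ≠ 0)
    (H₀ H₁ H₂ : Matrix ν ν ℝ) (Q₁₀ Q₁₁ Q₁₂ : Matrix μ ν ℝ) (Q₂₀ Q₂₁ Q₂₂ : Matrix κ μ ℝ) (G₀ G₁ G₂ : Matrix μ μ ℝ)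
    (τ₁ : Matrix ρ₁ ν ℝ) (τ₂ : Matrix ρ₂ μ ℝ) (P : Matrix (ρ₂ ⊕ ρ₁) ν ℝ) (W₀ W₁ W₂ : Matrix ν (ρ₂ ⊕ ρ₁) ℝ) (Y₀ Y₁ Y₂ : Matrix κ (ρ₂ ⊕ ρ₁) ℝ)
    (A₀ A₁ A₂ A'₀ A'₁ A'₂ : Matrix ν ν ℝ) (Ā₀ Ā₁ Ā₂ : Matrix κ κ ℝ)
    (W'₀ W'₁ W'₂ : Matrix ν (ρ₂ ⊕ ρ₁) ℝ) (C₀ C₁ C₂ : Matrix (ρ₂ ⊕ ρ₁) (ρ₂ ⊕ ρ₁) ℝ)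
    {𝔎₀ 𝔎₁ 𝔎₂ : Matrix ν ν ℝ} {𝔔₀ 𝔔₁ 𝔔₂ : Matrix κ ν ℝ}
    -- GRADED namings of the composite jets of the NESTED chart (as the door p323821)
    (h𝔎₀ : H₀ + Q₁₀ᵀ * G₀ * Q₁₀ = 𝔎₀) (h𝔎₁ : H₁ + (-(Q₁₁ᵀ * G₀ * Q₁₀) + Q₁₀ᵀ * G₁ * Q₁₀ + Q₁₀ᵀ * G₀ * Q₁₁) = 𝔎₁)
    (h𝔎₂ : H₂ + ((Q₁₂ᵀ * G₀ * Q₁₀ + -(Q₁₁ᵀ * G₁ * Q₁₀) + -(Q₁₁ᵀ * G₀ * Q₁₁)) + (-(Q₁₁ᵀ * G₁ * Q₁₀) + Q₁₀ᵀ * G₂ * Q₁₀ + Q₁₀ᵀ * G₁ * Q₁₁)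
            + (-(Q₁₁ᵀ * G₀ * Q₁₁) + Q₁₀ᵀ * G₁ * Q₁₁ + Q₁₀ᵀ * G₀ * Q₁₂)) = 𝔎₂)
    (h𝔔₀ : Q₂₀ * Q₁₀ = 𝔔₀) (h𝔔₁ : Q₂₁ * Q₁₀ + Q₂₀ * Q₁₁ = 𝔔₁) (h𝔔₂ : Q₂₂ * Q₁₀ + Q₂₁ * Q₁₁ + (Q₂₁ * Q₁₁ + Q₂₀ * Q₁₂) = 𝔔₂)
    -- (T-β-1) GRADED: the ONE-SHOT literal's composite jets are the graded conjugated words, NAMED (words led by `A₁ᵀ` negative)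
    {𝔎'₀ 𝔎'₁ 𝔎'₂ : Matrix ν ν ℝ} {𝔔'₀ 𝔔'₁ 𝔔'₂ : Matrix κ ν ℝ}
    (k0 : A₀ᵀ * 𝔎₀ * A₀ = 𝔎'₀) (k1 : -(A₁ᵀ * 𝔎₀ * A₀) + A₀ᵀ * 𝔎₁ * A₀ + A₀ᵀ * 𝔎₀ * A₁ = 𝔎'₁)
    (k2 : A₂ᵀ * 𝔎₀ * A₀ + (-(A₁ᵀ * 𝔎₁ * A₀) + -(A₁ᵀ * 𝔎₀ * A₁))
            + ((-(A₁ᵀ * 𝔎₁ * A₀) + -(A₁ᵀ * 𝔎₀ * A₁)) + (A₀ᵀ * 𝔎₂ * A₀ + A₀ᵀ * 𝔎₁ * A₁ + (A₀ᵀ * 𝔎₁ * A₁ + A₀ᵀ * 𝔎₀ * A₂))) = 𝔎'₂)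
    (q0 : Ā₀ * 𝔔₀ * A₀ = 𝔔'₀) (q1 : Ā₁ * 𝔔₀ * A₀ + Ā₀ * 𝔔₁ * A₀ + Ā₀ * 𝔔₀ * A₁ = 𝔔'₁)
    (q2 : Ā₂ * 𝔔₀ * A₀ + (Ā₁ * 𝔔₁ * A₀ + Ā₁ * 𝔔₀ * A₁)
            + ((Ā₁ * 𝔔₁ * A₀ + Ā₁ * 𝔔₀ * A₁) + (Ā₀ * 𝔔₂ * A₀ + Ā₀ * 𝔔₁ * A₁ + (Ā₀ * 𝔔₁ * A₁ + Ā₀ * 𝔔₀ * A₂))) = 𝔔'₂)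
    -- (T-β-2) unimodular transports, (T-β-3) inverse letters (one-sided: unchanged by the grading)
    (hA : A₀.det ≠ 0) (hĀ : Ā₀.det ≠ 0)
    (i0 : A'₀ * A₀ = 1) (i1 : A'₁ * A₀ + A'₀ * A₁ = 0) (i2 : A'₂ * A₀ + (2 : ℝ) • (A'₁ * A₁) + A'₀ * A₂ = 0)
    (uA : secondVar A₀ A₁ A₂ = 0) (uĀ : secondVar Ā₀ Ā₁ Ā₂ = 0)
    -- (T-β-4) intertwining: the transported nested-chart generators are the one-shot chart's generators re-parametrised by a unimodular `C`
    (j0 : A'₀ * W₀ = W'₀ * C₀) (j1 : A'₁ * W₀ + A'₀ * W₁ = W'₁ * C₀ + W'₀ * C₁)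
    (j2 : A'₂ * W₀ + (2 : ℝ) • (A'₁ * W₁) + A'₀ * W₂ = W'₂ * C₀ + (2 : ℝ) • (W'₁ * C₁) + W'₀ * C₂)
    (hC : C₀.det ≠ 0) (uC : secondVar C₀ C₁ C₂ = 0)
    -- the two chart-native (UNI)-jet letters
    (uP' : secondVar (P * W'₀) (P * W'₁) (P * W'₂) = 0)
    (uT : secondVar (fromRows (τ₂ * Q₁₀) τ₁ * W₀) (fromRows (τ₂ * Q₁₁) (0 : Matrix ρ₁ ν ℝ) * W₀ + fromRows (τ₂ * Q₁₀) τ₁ * W₁)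
      (fromRows (τ₂ * Q₁₂) (0 : Matrix ρ₁ ν ℝ) * W₀ + fromRows (τ₂ * Q₁₁) (0 : Matrix ρ₁ ν ℝ) * W₁
        + (fromRows (τ₂ * Q₁₁) (0 : Matrix ρ₁ ν ℝ) * W₁ + fromRows (τ₂ * Q₁₀) τ₁ * W₂)) = 0)
    -- parities of the composite form jets of the nested chart (the two-sided letters follow)
    (h𝔎₀t : 𝔎₀ᵀ = 𝔎₀) (h𝔎₁t : 𝔎₁ᵀ = -𝔎₁) (h𝔎₂t : 𝔎₂ᵀ = 𝔎₂)
    -- GRADED one-sided Ward letters of the composite system, NESTED chart (as the door p323821)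
    (a0 : 𝔎₀ * W₀ = 𝔔₀ᵀ * Y₀) (a1 : 𝔎₁ * W₀ + 𝔎₀ * W₁ = -(𝔔₁ᵀ * Y₀) + 𝔔₀ᵀ * Y₁)
    (a2 : 𝔎₂ * W₀ + (2 : ℝ) • (𝔎₁ * W₁) + 𝔎₀ * W₂ = 𝔔₂ᵀ * Y₀ + -((2 : ℝ) • (𝔔₁ᵀ * Y₁)) + 𝔔₀ᵀ * Y₂)
    (b0 : 𝔔₀ * W₀ = 0) (b1 : 𝔔₁ * W₀ + 𝔔₀ * W₁ = 0) (b2 : 𝔔₂ * W₀ + (2 : ℝ) • (𝔔₁ * W₁) + 𝔔₀ * W₂ = 0)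
    (hPW : (P * W₀).det ≠ 0) (hTW : (fromRows (τ₂ * Q₁₀) τ₁ * W₀).det ≠ 0) (hPW' : (P * W'₀).det ≠ 0)
    {Γ : Matrix ν ν ℝ} {I : Matrix ν (μ ⊕ ρ₁) ℝ} {L : Matrix (μ ⊕ ρ₁) ν ℝ} {S : Matrix (μ ⊕ ρ₁) (μ ⊕ ρ₁) ℝ} {B : Matrix (μ ⊕ ρ₁) ν ℝ}
    (hΓ : flucCov H₀ (fromRows Q₁₀ τ₁) = Γ) (hI : minOp H₀ (fromRows Q₁₀ τ₁) = I) (hL : minOpL H₀ (fromRows Q₁₀ τ₁) = L) (hS : effForm H₀ (fromRows Q₁₀ τ₁) = S)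
    (hB : fromRows Q₁₁ (0 : Matrix ρ₁ ν ℝ) = B)
    (h1 : (kkt H₀ (fromRows Q₁₀ τ₁)).det ≠ 0)
    (h2 : (kkt (S.toBlocks₁₁ + G₀) (fromRows Q₂₀ τ₂)).det ≠ 0) :
    secondVar (kkt 𝔎'₀ (fromRows 𝔔'₀ P))
        (fromBlocks 𝔎'₁ (-(fromRows 𝔔'₁ (0 : Matrix (ρ₂ ⊕ ρ₁) ν ℝ))ᵀ) (fromRows 𝔔'₁ (0 : Matrix (ρ₂ ⊕ ρ₁) ν ℝ)) 0)
        (kkt 𝔎'₂ (fromRows 𝔔'₂ (0 : Matrix (ρ₂ ⊕ ρ₁) ν ℝ)))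
      = secondVar (kkt H₀ (fromRows Q₁₀ τ₁)) (fromBlocks H₁ (-Bᵀ) B 0) (kkt H₂ (fromRows Q₁₂ (0 : Matrix ρ₁ ν ℝ)))
        + secondVar
            (kkt (S.toBlocks₁₁ + G₀) (fromRows Q₂₀ τ₂))
            (fromBlocks (((L * H₁ - S * B) * I + L * Bᵀ * S).toBlocks₁₁ + G₁) (-(fromRows Q₂₁ (0 : Matrix ρ₂ μ ℝ))ᵀ)
              (fromRows Q₂₁ (0 : Matrix ρ₂ μ ℝ)) 0)
            (kkt ((((-((L * H₁ - S * B) * Γ - L * Bᵀ * L) * H₁ + L * H₂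
                      - (((L * H₁ - S * B) * I + L * Bᵀ * S) * B + S * fromRows Q₁₂ (0 : Matrix ρ₁ ν ℝ))) * I
                    + (L * H₁ - S * B) * (-((Γ * H₁ + I * B) * I + Γ * Bᵀ * S)))
                  - ((-((L * H₁ - S * B) * Γ - L * Bᵀ * L) * (-Bᵀ) + L * (fromRows Q₁₂ (0 : Matrix ρ₁ ν ℝ))ᵀ) * S
                      + L * (-Bᵀ) * ((L * H₁ - S * B) * I + L * Bᵀ * S))).toBlocks₁₁ + G₂)
              (fromRows Q₂₂ (0 : Matrix ρ₂ μ ℝ))) := by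
  have hPAW : (P * A'₀ * W₀).det ≠ 0 := by
    rw [Matrix.mul_assoc, j0, ← Matrix.mul_assoc, Matrix.det_mul]; exact mul_ne_zero hPW' hC
  rw [secondVar_oneShot_nestedStepLaw_transported_graded c hc htr H₀ H₁ H₂ Q₁₀ Q₁₁ Q₁₂ Q₂₀ Q₂₁ Q₂₂ G₀ G₁ G₂ τ₁ τ₂ P W₀ W₁ W₂ Y₀ Y₁ Y₂
      A₀ A₁ A₂ A'₀ A'₁ A'₂ Ā₀ Ā₁ Ā₂ h𝔎₀ h𝔎₁ h𝔎₂ h𝔔₀ h𝔔₁ h𝔔₂ k0 k1 k2 q0 q1 q2 hA hĀ i0 i1 i2 uA uĀ h𝔎₀t h𝔎₁t h𝔎₂t a0 a1 a2 b0 b1 b2 hPW hTW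
      hPAW hΓ hI hL hS hB h1 h2,
    secondVar_movedOneShotFP_eq_zero_of_uni P W₀ W₁ W₂ W'₀ W'₁ W'₂ A'₀ A'₁ A'₂ C₀ C₁ C₂ j0 j1 j2 hPW' hC uC uP', uT, mul_zero, sub_zero, add_zero]

/-- [folklore] **THE GRADED TRANSPORTED LAW UNDER THE DEAD-ROW LETTERS: ZERO DEFECT.**  As `…_of_uni`, with the two (UNI)-jet letters supplied by the six
dead-row letters — `P·W♯₁ = P·W♯₂ = 0` (one-shot chart), `τ₁·W₁ = τ₁·W₂ = 0`, `τ₂·(Q₁₁W₀ + Q₁₀W₁) = 0`, `τ₂·(Q₁₂W₀ + 2•Q₁₁W₁ + Q₁₀W₂) = 0` (nested chart). -/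
theorem secondVar_oneShot_nestedStepLaw_transported_graded_of_letters
    (c : Matrix l l ℝ) (hc : cᵀ = -c) (htr : (c * c).trace ≠ 0)
    (H₀ H₁ H₂ : Matrix ν ν ℝ) (Q₁₀ Q₁₁ Q₁₂ : Matrix μ ν ℝ) (Q₂₀ Q₂₁ Q₂₂ : Matrix κ μ ℝ) (G₀ G₁ G₂ : Matrix μ μ ℝ)
    (τ₁ : Matrix ρ₁ ν ℝ) (τ₂ : Matrix ρ₂ μ ℝ) (P : Matrix (ρ₂ ⊕ ρ₁) ν ℝ) (W₀ W₁ W₂ : Matrix ν (ρ₂ ⊕ ρ₁) ℝ) (Y₀ Y₁ Y₂ : Matrix κ (ρ₂ ⊕ ρ₁) ℝ)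
    (A₀ A₁ A₂ A'₀ A'₁ A'₂ : Matrix ν ν ℝ) (Ā₀ Ā₁ Ā₂ : Matrix κ κ ℝ)
    (W'₀ W'₁ W'₂ : Matrix ν (ρ₂ ⊕ ρ₁) ℝ) (C₀ C₁ C₂ : Matrix (ρ₂ ⊕ ρ₁) (ρ₂ ⊕ ρ₁) ℝ)
    {𝔎₀ 𝔎₁ 𝔎₂ : Matrix ν ν ℝ} {𝔔₀ 𝔔₁ 𝔔₂ : Matrix κ ν ℝ}
    -- GRADED namings of the composite jets of the NESTED chart (as the door p323821)
    (h𝔎₀ : H₀ + Q₁₀ᵀ * G₀ * Q₁₀ = 𝔎₀) (h𝔎₁ : H₁ + (-(Q₁₁ᵀ * G₀ * Q₁₀) + Q₁₀ᵀ * G₁ * Q₁₀ + Q₁₀ᵀ * G₀ * Q₁₁) = 𝔎₁)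
    (h𝔎₂ : H₂ + ((Q₁₂ᵀ * G₀ * Q₁₀ + -(Q₁₁ᵀ * G₁ * Q₁₀) + -(Q₁₁ᵀ * G₀ * Q₁₁)) + (-(Q₁₁ᵀ * G₁ * Q₁₀) + Q₁₀ᵀ * G₂ * Q₁₀ + Q₁₀ᵀ * G₁ * Q₁₁)
            + (-(Q₁₁ᵀ * G₀ * Q₁₁) + Q₁₀ᵀ * G₁ * Q₁₁ + Q₁₀ᵀ * G₀ * Q₁₂)) = 𝔎₂)
    (h𝔔₀ : Q₂₀ * Q₁₀ = 𝔔₀) (h𝔔₁ : Q₂₁ * Q₁₀ + Q₂₀ * Q₁₁ = 𝔔₁) (h𝔔₂ : Q₂₂ * Q₁₀ + Q₂₁ * Q₁₁ + (Q₂₁ * Q₁₁ + Q₂₀ * Q₁₂) = 𝔔₂)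
    -- (T-β-1) GRADED: the ONE-SHOT literal's composite jets are the graded conjugated words, NAMED (words led by `A₁ᵀ` negative)
    {𝔎'₀ 𝔎'₁ 𝔎'₂ : Matrix ν ν ℝ} {𝔔'₀ 𝔔'₁ 𝔔'₂ : Matrix κ ν ℝ}
    (k0 : A₀ᵀ * 𝔎₀ * A₀ = 𝔎'₀) (k1 : -(A₁ᵀ * 𝔎₀ * A₀) + A₀ᵀ * 𝔎₁ * A₀ + A₀ᵀ * 𝔎₀ * A₁ = 𝔎'₁)
    (k2 : A₂ᵀ * 𝔎₀ * A₀ + (-(A₁ᵀ * 𝔎₁ * A₀) + -(A₁ᵀ * 𝔎₀ * A₁))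
            + ((-(A₁ᵀ * 𝔎₁ * A₀) + -(A₁ᵀ * 𝔎₀ * A₁)) + (A₀ᵀ * 𝔎₂ * A₀ + A₀ᵀ * 𝔎₁ * A₁ + (A₀ᵀ * 𝔎₁ * A₁ + A₀ᵀ * 𝔎₀ * A₂))) = 𝔎'₂)
    (q0 : Ā₀ * 𝔔₀ * A₀ = 𝔔'₀) (q1 : Ā₁ * 𝔔₀ * A₀ + Ā₀ * 𝔔₁ * A₀ + Ā₀ * 𝔔₀ * A₁ = 𝔔'₁)
    (q2 : Ā₂ * 𝔔₀ * A₀ + (Ā₁ * 𝔔₁ * A₀ + Ā₁ * 𝔔₀ * A₁)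
            + ((Ā₁ * 𝔔₁ * A₀ + Ā₁ * 𝔔₀ * A₁) + (Ā₀ * 𝔔₂ * A₀ + Ā₀ * 𝔔₁ * A₁ + (Ā₀ * 𝔔₁ * A₁ + Ā₀ * 𝔔₀ * A₂))) = 𝔔'₂)
    -- (T-β-2) unimodular transports, (T-β-3) inverse letters (one-sided: unchanged by the grading)
    (hA : A₀.det ≠ 0) (hĀ : Ā₀.det ≠ 0)
    (i0 : A'₀ * A₀ = 1) (i1 : A'₁ * A₀ + A'₀ * A₁ = 0) (i2 : A'₂ * A₀ + (2 : ℝ) • (A'₁ * A₁) + A'₀ * A₂ = 0)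
    (uA : secondVar A₀ A₁ A₂ = 0) (uĀ : secondVar Ā₀ Ā₁ Ā₂ = 0)
    (j0 : A'₀ * W₀ = W'₀ * C₀) (j1 : A'₁ * W₀ + A'₀ * W₁ = W'₁ * C₀ + W'₀ * C₁)
    (j2 : A'₂ * W₀ + (2 : ℝ) • (A'₁ * W₁) + A'₀ * W₂ = W'₂ * C₀ + (2 : ℝ) • (W'₁ * C₁) + W'₀ * C₂)
    (hC : C₀.det ≠ 0) (uC : secondVar C₀ C₁ C₂ = 0)
    -- dead rows: the one-shot slice along the one-shot family; the nested slice along the nested family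
    (p1 : P * W'₁ = 0) (p2 : P * W'₂ = 0)
    (s1 : τ₁ * W₁ = 0) (s2 : τ₁ * W₂ = 0) (t1 : τ₂ * (Q₁₁ * W₀ + Q₁₀ * W₁) = 0) (t2 : τ₂ * (Q₁₂ * W₀ + (2 : ℝ) • (Q₁₁ * W₁) + Q₁₀ * W₂) = 0)
    -- parities of the composite form jets of the nested chart (the two-sided letters follow)
    (h𝔎₀t : 𝔎₀ᵀ = 𝔎₀) (h𝔎₁t : 𝔎₁ᵀ = -𝔎₁) (h𝔎₂t : 𝔎₂ᵀ = 𝔎₂)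
    -- GRADED one-sided Ward letters of the composite system, NESTED chart (as the door p323821)
    (a0 : 𝔎₀ * W₀ = 𝔔₀ᵀ * Y₀) (a1 : 𝔎₁ * W₀ + 𝔎₀ * W₁ = -(𝔔₁ᵀ * Y₀) + 𝔔₀ᵀ * Y₁)
    (a2 : 𝔎₂ * W₀ + (2 : ℝ) • (𝔎₁ * W₁) + 𝔎₀ * W₂ = 𝔔₂ᵀ * Y₀ + -((2 : ℝ) • (𝔔₁ᵀ * Y₁)) + 𝔔₀ᵀ * Y₂)
    (b0 : 𝔔₀ * W₀ = 0) (b1 : 𝔔₁ * W₀ + 𝔔₀ * W₁ = 0) (b2 : 𝔔₂ * W₀ + (2 : ℝ) • (𝔔₁ * W₁) + 𝔔₀ * W₂ = 0)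
    (hPW : (P * W₀).det ≠ 0) (hTW : (fromRows (τ₂ * Q₁₀) τ₁ * W₀).det ≠ 0) (hPW' : (P * W'₀).det ≠ 0)
    {Γ : Matrix ν ν ℝ} {I : Matrix ν (μ ⊕ ρ₁) ℝ} {L : Matrix (μ ⊕ ρ₁) ν ℝ} {S : Matrix (μ ⊕ ρ₁) (μ ⊕ ρ₁) ℝ} {B : Matrix (μ ⊕ ρ₁) ν ℝ}
    (hΓ : flucCov H₀ (fromRows Q₁₀ τ₁) = Γ) (hI : minOp H₀ (fromRows Q₁₀ τ₁) = I) (hL : minOpL H₀ (fromRows Q₁₀ τ₁) = L) (hS : effForm H₀ (fromRows Q₁₀ τ₁) = S)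
    (hB : fromRows Q₁₁ (0 : Matrix ρ₁ ν ℝ) = B)
    (h1 : (kkt H₀ (fromRows Q₁₀ τ₁)).det ≠ 0)
    (h2 : (kkt (S.toBlocks₁₁ + G₀) (fromRows Q₂₀ τ₂)).det ≠ 0) :
    secondVar (kkt 𝔎'₀ (fromRows 𝔔'₀ P))
        (fromBlocks 𝔎'₁ (-(fromRows 𝔔'₁ (0 : Matrix (ρ₂ ⊕ ρ₁) ν ℝ))ᵀ) (fromRows 𝔔'₁ (0 : Matrix (ρ₂ ⊕ ρ₁) ν ℝ)) 0)
        (kkt 𝔎'₂ (fromRows 𝔔'₂ (0 : Matrix (ρ₂ ⊕ ρ₁) ν ℝ)))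
      = secondVar (kkt H₀ (fromRows Q₁₀ τ₁)) (fromBlocks H₁ (-Bᵀ) B 0) (kkt H₂ (fromRows Q₁₂ (0 : Matrix ρ₁ ν ℝ)))
        + secondVar
            (kkt (S.toBlocks₁₁ + G₀) (fromRows Q₂₀ τ₂))
            (fromBlocks (((L * H₁ - S * B) * I + L * Bᵀ * S).toBlocks₁₁ + G₁) (-(fromRows Q₂₁ (0 : Matrix ρ₂ μ ℝ))ᵀ)
              (fromRows Q₂₁ (0 : Matrix ρ₂ μ ℝ)) 0)
            (kkt ((((-((L * H₁ - S * B) * Γ - L * Bᵀ * L) * H₁ + L * H₂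
                      - (((L * H₁ - S * B) * I + L * Bᵀ * S) * B + S * fromRows Q₁₂ (0 : Matrix ρ₁ ν ℝ))) * I
                    + (L * H₁ - S * B) * (-((Γ * H₁ + I * B) * I + Γ * Bᵀ * S)))
                  - ((-((L * H₁ - S * B) * Γ - L * Bᵀ * L) * (-Bᵀ) + L * (fromRows Q₁₂ (0 : Matrix ρ₁ ν ℝ))ᵀ) * S
                      + L * (-Bᵀ) * ((L * H₁ - S * B) * I + L * Bᵀ * S))).toBlocks₁₁ + G₂)
              (fromRows Q₂₂ (0 : Matrix ρ₂ μ ℝ))) :=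
  secondVar_oneShot_nestedStepLaw_transported_graded_of_uni c hc htr H₀ H₁ H₂ Q₁₀ Q₁₁ Q₁₂ Q₂₀ Q₂₁ Q₂₂ G₀ G₁ G₂ τ₁ τ₂ P W₀ W₁ W₂ Y₀ Y₁ Y₂
    A₀ A₁ A₂ A'₀ A'₁ A'₂ Ā₀ Ā₁ Ā₂ W'₀ W'₁ W'₂ C₀ C₁ C₂ h𝔎₀ h𝔎₁ h𝔎₂ h𝔔₀ h𝔔₁ h𝔔₂ k0 k1 k2 q0 q1 q2 hA hĀ i0 i1 i2 uA uĀ j0 j1 j2 hC uC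
    (by rw [p1, p2]; exact CombSliceJetLetters.secondVar_zero_jets _) (secondVar_nestedFP_eq_zero τ₁ τ₂ Q₁₀ Q₁₁ Q₁₂ W₀ W₁ W₂ s1 s2 t1 t2)
    h𝔎₀t h𝔎₁t h𝔎₂t a0 a1 a2 b0 b1 b2 hPW hTW hPW' hΓ hI hL hS hB h1 h2

end Summit.QuantumFields.BalabanUV.Beta.FP.NestedStepLawTransportedGraded

end
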